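import Literature.Probability.LatticeModels.RCBoxAmbient
import Literature.Probability.LatticeModels.RandomClusterFKG
import Mathlib.Algebra.Order.Field.GeomSum
import HarnessLib

/-!
# Random-cluster contours: the box measures as volume ensembles, and the Peierls sums

Topic `Literature/Probability/LatticeModels`. The probabilistic end of the contour analysis of the
random-cluster model (Grimmett 2006, §7.5, proof of Thm. (7.33); Friedli–Velenik 2017, §7.3): the
finite-volume random-cluster measures on boxes are identified *exactly* with the `ord`/`dis` volume
ensembles of the contour files, and the Pirogov–Sinai output `K(γ) ≤ e^{-τ̂|γ̄|}` is turned into bounds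
on connection probabilities.

1. **Wired boxes** (`Λ = Λ_{N+1}` wired on `∂Λ`, volume `V = Λ_{N+3}`, free edges `F` = edges touching
   `Λ_N`): with `t² = p/(1-p)`, `rcWeight¹(ω) = C · (t²)^{|ω ∖ F|} · wt^{ord}_V(ω ∩ F)` (handshake
   `E = 2|ω| + pinned`, cluster gluing `k¹_Λ(ω) = κ^{ord}_V(ω ∩ F) + 1` along `∂Λ`), whence the
   `φ¹_{Λ,p,q}`-probability of an `F`-measurable event is its ensemble probability
   (`real_rcMeasure_wired_eq_ensProb`); the event `0 ↔ ∂Λ` is the chain event `Aev N`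
   (`real_rcMeasure_wired_origin`) and its failure puts `0` in the hull of an external contour
   (`ensProb_not_aev_le`).
2. **Free boxes** (`Λ = Λ_N` free, `V = Λ_{N+3}`, `F = E_Λ ∪ pendant edges`): pendant edges to fresh
   vertices contribute the constant factor `1 + t²/q` each (`ccount_free_pendant`,
   `real_rcMeasure_free_eq_ensProb`); the event `0 ↔ ∂Λ_m in Λ_m` (`Pm m`, `mem_preimage_origin_iff`) forces
   in the `dis` ensemble an external contour around `0` of size `≥ m+1` (`exists_big_hull_of_pm`).
3. **Peierls sums**: the union bound `ensProb(∃ external γ, P γ) ≤ Σ_{γ: P γ} K(γ)` from Lemma 7.26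
   (`sum_wt_filter_le_K_mul` of `RCContourModel`), the count
   `#{γ : 0 ∈ hull γ, |γ̄| = s} ≤ s (3^d)^{2(s-1)} (4^{3^d})^s`, and the geometric tail
   `Σ_{0 ∈ hull γ, |γ̄| ≥ m+1} K(γ) ≤ B^{m+1}/(1-B)`, `B = 2·9^d·4^{3^d}·e^{-τ̂}`.

Everything is proved; no named facts.

## References

* G. Grimmett, *The Random-Cluster Model*, Springer 2006, §4.2 (boundary conditions on boxes),
  §7.5 (proof of Thm. (7.33), eqs. (7.79)–(7.83)). [Grimmett2006]
* S. Friedli, Y. Velenik, *Statistical Mechanics of Lattice Systems*, CUP 2017, §7.3 (the measures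
  μ^#_Λ, Lemma 7.20, Lemma 7.23, Lemma 7.26), §7.4. [FriedliVelenik2017]
-/

noncomputable section

open Finset Relation SimpleGraph

namespace Literature.Probability.LatticeModels

namespace RCC

open ContourSetup ClassCount

variable {d : ℕ}

/-! ## Part 1: wired boxes -/


/-- The configuration weights are positive (`t, q > 0`). [folklore] -/
theorem wt_pos {t q : ℝ} (ht : 0 < t) (hq : 0 < q) (σ : Phase) (U : Finset (Site d)) (ω : Finset (Sym2 (Site d))) :
    0 < wt t q σ U ω := mul_pos (pow_pos ht _) (pow_pos hq _)

/-- Subsets of a disjoint union are unions of pairs of subsets. [folklore] -/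
theorem sum_powerset_union {β : Type*} [DecidableEq β] {T U : Finset β} (h : Disjoint T U) (f : Finset β → ℝ) :
    ∑ s ∈ (T ∪ U).powerset, f s = ∑ a ∈ T.powerset, ∑ b ∈ U.powerset, f (a ∪ b) := by
  rw [← sum_product']
  refine sum_nbij' (fun s => (s ∩ T, s ∩ U)) (fun p => p.1 ∪ p.2) (fun s hs => ?_) (fun p hp => ?_) (fun s hs => ?_)
    (fun p hp => ?_) (fun s hs => ?_)
  · exact mem_product.2 ⟨mem_powerset.2 inter_subset_right, mem_powerset.2 inter_subset_right⟩
  · obtain ⟨h1, h2⟩ := mem_product.1 hp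
    exact mem_powerset.2 (union_subset_union (mem_powerset.1 h1) (mem_powerset.1 h2))
  · have := mem_powerset.1 hs
    rw [← inter_union_distrib_left, inter_eq_left.2 this]
  · obtain ⟨h1, h2⟩ := mem_product.1 hp
    have h1 := mem_powerset.1 h1; have h2 := mem_powerset.1 h2
    ext <;> simp only [union_inter_distrib_right]
    · rw [inter_eq_left.2 h1, disjoint_iff_inter_eq_empty.1 (h.symm.mono_left h2), union_empty]
    · rw [inter_eq_left.2 h2, disjoint_iff_inter_eq_empty.1 (h.mono_left h1), empty_union]
  · have := mem_powerset.1 hs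
    simp only
    rw [← inter_union_distrib_left, inter_eq_left.2 this]

/-! ### Ensemble probabilities -/

/-- The probability of an event in the `σ`-ensemble of the volume `V`: `Σ_{ω ⊆ F : P ω} t^E q^κ / Z`.
[cite: FriedliVelenik2017, §7.3, eq. (7.23)] -/
def ensProb (t q : ℝ) (σ : Phase) (V : Finset (Site d)) (P : Finset (Sym2 (Site d)) → Prop) [DecidablePred P] : ℝ :=
  (∑ ω ∈ (freeEdges V).powerset with P ω, wt t q σ V ω) / Zrc t q σ V

/-- Ensemble probabilities are monotone in the event. [folklore] -/
theorem ensProb_mono {t q : ℝ} (ht : 0 < t) (hq : 0 < q) {σ : Phase} {V : Finset (Site d)} {P Q : Finset (Sym2 (Site d)) → Prop}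
    [DecidablePred P] [DecidablePred Q] (h : ∀ ω ⊆ freeEdges V, P ω → Q ω) : ensProb t q σ V P ≤ ensProb t q σ V Q := by
  refine div_le_div_of_nonneg_right (sum_le_sum_of_subset_of_nonneg (fun ω hω => ?_) fun ω _ _ => (wt_pos ht hq σ V ω).le)
    (Zrc_pos ht hq σ V).le
  obtain ⟨hω, hP⟩ := mem_filter.1 hω
  exact mem_filter.2 ⟨hω, h ω (mem_powerset.1 hω) hP⟩

/-- Ensemble probabilities with the sum written as an indicator sum. [folklore] -/
theorem ensProb_eq_sum_ite {t q : ℝ} {σ : Phase} {V : Finset (Site d)} (P : Finset (Sym2 (Site d)) → Prop) [DecidablePred P] :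
    ensProb t q σ V P = (∑ ω ∈ (freeEdges V).powerset, if P ω then wt t q σ V ω else 0) / Zrc t q σ V := by
  rw [ensProb, sum_filter]

/-! ### The wired box setting -/

section Wired

variable (hd : 2 ≤ d) (N : ℕ)

/-- The boundary layer `∂Λ_{N+1} = Λ_{N+1} ∖ Λ_N`. [cite: Grimmett2006, §4.2] -/
abbrev bdry (d N : ℕ) : Finset (Site d) := innerBoundary (zdGraph d) (box d (N + 1))

/-- The connection event `0 ↔ ∂Λ_{N+1}` for an ambient configuration (chains inside `Λ_{N+1}`).
[cite: Grimmett2006, Prop. (5.11)] -/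
def Aev (N : ℕ) (ω : Finset (Sym2 (Site d))) : Prop := ∃ y ∈ bdry d N, ReflTransGen (relIn (Rcfg ω) (box d (N + 1))) 0 y

omit hd in
/-- An edge with an endpoint in `Λ_N` is free in `Λ_{N+3}`. [folklore] -/
theorem mk_mem_freeEdges_of_mem {a b : Site d} (hab : (zdGraph d).Adj a b) (h : a ∈ box d N ∨ b ∈ box d N) :
    s(a, b) ∈ freeEdges (box d (N + 3)) :=
  mem_freeEdges_box.2 ⟨(SimpleGraph.mem_edgeSet _).2 hab, h.elim (fun ha => ⟨a, Sym2.mem_mk_left a b, ha⟩)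
    fun hb => ⟨b, Sym2.mem_mk_right a b, hb⟩⟩

omit hd in
/-- A lattice neighbour of a point of `Λ_N` lies in `Λ_{N+1}`. [folklore] -/
theorem mem_box_succ_of_adj {a b : Site d} (hab : (zdGraph d).Adj a b) (ha : a ∈ box d N) : b ∈ box d (N + 1) :=
  starBall_subset_box_succ ha ((adj_iff_mem_starBall.1 (zdGraph_le_zdStar hab)).1)

omit hd in
/-- **The connection event depends only on the free edges** (first exit from `Λ_N`).
[cite: Grimmett2006, §4.2] -/
theorem aev_iff_aev_inter {ω : Finset (Sym2 (Site d))} : Aev N ω ↔ Aev N (ω ∩ freeEdges (box d (N + 3))) := by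
  classical
  constructor
  · rintro ⟨y, hy, h⟩
    have hy' : y ∉ box d N := by rw [bdry, innerBoundary_box_succ] at hy; exact (mem_sdiff.1 hy).2
    have h0 : (0 : Site d) ∈ box d N := zero_mem_box (d := d) N
    have hno : ¬ ReflTransGen (relIn (Rcfg ω) (box d (N + 1) ∩ box d N)) 0 y := fun h' =>
      hy' (mem_inter.1 (ClassCount.mem_of_reflTransGen h' (mem_inter.2 ⟨zero_mem_box (d := d) (N + 1), h0⟩))).2
    obtain ⟨p, v, hp, hv, hpv, h0p, -⟩ := ClassCount.exists_first_exit h h0 hno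
    refine ⟨v, ?_, ?_⟩
    · rw [bdry, innerBoundary_box_succ, mem_sdiff]; exact ⟨hpv.2.2, hv⟩
    · have h1 : ReflTransGen (relIn (Rcfg (ω ∩ freeEdges (box d (N + 3)))) (box d (N + 1))) 0 p := by
        refine ClassCount.reflTransGen_of_subset inter_subset_left (ClassCount.reflTransGen_mono (fun a ha b hb hab => ?_) h0p)
        exact ⟨hab.1, mem_inter.2 ⟨hab.2, mk_mem_freeEdges_of_mem N hab.1 (Or.inl (mem_inter.1 ha).2)⟩⟩
      exact h1.tail ⟨⟨hpv.1.1, mem_inter.2 ⟨hpv.1.2, mk_mem_freeEdges_of_mem N hpv.1.1 (Or.inl hp)⟩⟩, hpv.2.1, hpv.2.2⟩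
  · rintro ⟨y, hy, h⟩
    exact ⟨y, hy, ClassCount.reflTransGen_mono (fun a _ b _ hab => ⟨hab.1, (mem_inter.1 hab.2).1⟩) h⟩

/-! ### The cluster identity `k¹_Λ(ω) = κ^{ord}_V(ω ∩ F) + 1` -/

omit hd in
/-- Edges inside `Λ_{N+1}` that are not free lie in the boundary layer. [folklore] -/
theorem mem_bdry_of_not_mem_freeEdges {a b : Site d} (hab : (zdGraph d).Adj a b) (ha : a ∈ box d (N + 1)) (hb : b ∈ box d (N + 1))
    (h : s(a, b) ∉ freeEdges (box d (N + 3))) : a ∈ bdry d N ∧ b ∈ bdry d N := by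
  rw [bdry, innerBoundary_box_succ, mem_sdiff, mem_sdiff]
  exact ⟨⟨ha, fun ha' => h (mk_mem_freeEdges_of_mem N hab (Or.inl ha'))⟩, ⟨hb, fun hb' => h (mk_mem_freeEdges_of_mem N hab (Or.inr hb'))⟩⟩

omit hd in
/-- **Dropping the non-free edges (inside the wired layer) does not change the wired class count.**
[cite: Grimmett2006, §4.2] -/
theorem ccount_wire_eq_inter (ω : Finset (Sym2 (Site d))) :
    ccount (wire (Rcfg ω) (bdry d N)) (box d (N + 1)) = ccount (wire (Rcfg (ω ∩ freeEdges (box d (N + 3)))) (bdry d N)) (box d (N + 1)) := by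
  refine ccount_congr fun a ha b hb => ?_
  rw [wire, wire, Rcfg, Rcfg, mem_inter]
  constructor
  · rintro (⟨hab, he⟩ | h)
    · by_cases hF : s(a, b) ∈ freeEdges (box d (N + 3))
      · exact Or.inl ⟨hab, he, hF⟩
      · exact Or.inr (mem_bdry_of_not_mem_freeEdges N hab ha hb hF)
    · exact Or.inr h
  · rintro (⟨hab, he, -⟩ | h)
    · exact Or.inl ⟨hab, he⟩
    · exact Or.inr h

/-- The big wired block `Λ_{N+3} ∖ Λ_N`. [folklore] -/
abbrev bigBlock (d N : ℕ) : Finset (Site d) := box d (N + 3) \ box d N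

omit hd in
/-- **Every point of `Λ_{N+3} ∖ Λ_N` is joined by open (non-free) edges inside `Λ_{N+3}` to the outer
layer `Λ_{N+3} ∖ Λ_{N+2}`** (push one large coordinate outwards). [folklore] -/
theorem exists_chain_to_layer_of_mem_bigBlock {ω : Finset (Sym2 (Site d))} (hω : ω ⊆ freeEdges (box d (N + 3))) {x : Site d}
    (hx : x ∈ bigBlock d N) :
    ∃ z ∈ box d (N + 3) \ inner1 (box d (N + 3)), ReflTransGen (relIn (ROpen Phase.ord (freeEdges (box d (N + 3))) ω) (box d (N + 3))) x z := by
  obtain ⟨hxV, hxN⟩ := mem_sdiff.1 hx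
  rw [mem_box, not_forall] at hxN
  obtain ⟨i, hi⟩ := hxN
  rw [show N + 3 = (N + 2) + 1 from rfl, inner1_box]
  -- induction on the gap to the outer face
  have key : ∀ (k : ℕ) (y : Site d), y ∈ box d (N + 3) → N + 1 ≤ (y i).natAbs → (y i).natAbs + k = N + 3 →
      ∃ z ∈ box d (N + 2 + 1) \ box d (N + 2), ReflTransGen (relIn (ROpen Phase.ord (freeEdges (box d (N + 3))) ω) (box d (N + 3))) y z := by
    intro k
    induction k with
    | zero =>
      intro y hy hyi hk
      refine ⟨y, mem_sdiff.2 ⟨hy, fun h => ?_⟩, ReflTransGen.refl⟩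
      have := (mem_box.1 h) i; omega
    | succ k ih =>
      intro y hy hyi hk
      set y' : Site d := Function.update y i (y i + if 0 ≤ y i then 1 else -1) with hy'
      have hadj : (zdGraph d).Adj y y' := by
        by_cases h0 : 0 ≤ y i
        · rw [hy', if_pos h0]; exact mem_nbrs.1 (nbrs_update_mem i).1
        · rw [hy', if_neg h0, ← sub_eq_add_neg]; exact mem_nbrs.1 (nbrs_update_mem i).2
      have hy'i : (y' i).natAbs = (y i).natAbs + 1 := by
        simp only [hy', Function.update_self]; split_ifs <;> omega
      have hy'V : y' ∈ box d (N + 3) := by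
        rw [mem_box] at hy ⊢
        intro j
        by_cases hj : j = i
        · subst hj; simp only [hy', Function.update_self]; have := hy j; split_ifs <;> omega
        · simp only [hy', Function.update_of_ne hj]; exact hy j
      have hyN : y ∉ box d N := fun h => by have := (mem_box.1 h) i; omega
      have hy'N : y' ∉ box d N := fun h => by have := (mem_box.1 h) i; omega
      have hopen : EOpen Phase.ord (freeEdges (box d (N + 3))) ω s(y, y') := by
        refine (eOpen_iff_of_not_mem hω fun hF => ?_).2 rfl
        obtain ⟨-, z, hz, hzN⟩ := mem_freeEdges_box.1 hF
        rcases Sym2.mem_iff.1 hz with rfl | rfl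
        · exact hyN hzN
        · exact hy'N hzN
      obtain ⟨z, hz, hchain⟩ := ih y' hy'V (by omega) (by omega)
      exact ⟨z, hz, ReflTransGen.head ⟨⟨hadj, hopen⟩, hy, hy'V⟩ hchain⟩
  exact key (N + 3 - (x i).natAbs) x hxV (by omega) (by have := (mem_box.1 hxV) i; omega)
  where
    nbrs_update_mem (i : Fin d) {x : Site d} : Function.update x i (x i + 1) ∈ nbrs x ∧ Function.update x i (x i - 1) ∈ nbrs x := by
      constructor
      · refine mem_nbrs.2 ((zdGraph_adj_iff _ _).2 ⟨i, Or.inl ?_⟩)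
        funext j; by_cases hj : j = i
        · subst hj; simp
        · simp [Function.update_of_ne hj, Pi.single_eq_of_ne hj]
      · refine mem_nbrs.2 ((zdGraph_adj_iff _ _).2 ⟨i, Or.inr ?_⟩)
        funext j; by_cases hj : j = i
        · subst hj; simp
        · simp [Function.update_of_ne hj, Pi.single_eq_of_ne hj]

omit hd in
/-- **The cluster identity** (FV: the wired count of `Λ` versus the volume functional): for
`ω ⊆ freeEdges Λ_{N+3}`, `κ^{ord}_{Λ_{N+3}}(ω) + 1 = ccount (wire (Rcfg ω) ∂Λ_{N+1}) Λ_{N+1}`.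
[cite: FriedliVelenik2017, §7.3, Lemma 7.20; Grimmett2006, §4.2] -/
theorem kappa_ord_box_add_one (hd1 : 1 ≤ d) {ω : Finset (Sym2 (Site d))} (hω : ω ⊆ freeEdges (box d (N + 3))) :
    kappa Phase.ord (box d (N + 3)) (freeEdges (box d (N + 3))) ω + 1 = ccount (wire (Rcfg ω) (bdry d N)) (box d (N + 1)) := by
  classical
  set V := box d (N + 3) with hV
  set F := freeEdges V with hF
  set R' := ROpen Phase.ord F ω with hR'
  set layer := V \ inner1 V with hlayer
  set Bb := bigBlock d N with hBb
  have hR's : ∀ a b, R' a b → R' b a := rOpen_symm _ _ _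
  have hlayerBb : layer ⊆ Bb := by
    rw [hlayer, hV, show N + 3 = (N + 2) + 1 from rfl, inner1_box]
    exact sdiff_subset_sdiff Subset.rfl (box_mono d (by omega))
  -- (c2) the big block is one class of `wire R' layer`
  have hone : ∀ a ∈ Bb, ∀ b ∈ Bb, ReflTransGen (relIn (wire R' layer) V) a b := by
    intro a ha b hb
    obtain ⟨z, hz, haz⟩ := exists_chain_to_layer_of_mem_bigBlock N hω ha
    obtain ⟨z', hz', hbz'⟩ := exists_chain_to_layer_of_mem_bigBlock N hω hb
    have hm : ∀ {x y}, ReflTransGen (relIn R' V) x y → ReflTransGen (relIn (wire R' layer) V) x y :=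
      fun h => reflTransGen_mono (fun _ _ _ _ h => Or.inl h) h
    exact ((hm haz).trans (ReflTransGen.single ⟨Or.inr ⟨hz, hz'⟩, (mem_sdiff.1 hz).1, (mem_sdiff.1 hz').1⟩)).trans
      (reflTransGen_symm (wire_symm hR's _) (hm hbz'))
  -- (c3) replace the layer wiring by the big block wiring
  have h3 : ccount (wire R' layer) V = ccount (wire R' Bb) V := by
    rw [← ccount_wire_eq (R := wire R' layer) (L := Bb) hone]
    refine ccount_congr fun a _ b _ => ?_
    rw [wire, wire, wire]
    constructor
    · rintro ((h | ⟨ha, hb⟩) | h)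
      · exact Or.inl h
      · exact Or.inr ⟨hlayerBb ha, hlayerBb hb⟩
      · exact Or.inr h
    · rintro (h | h)
      · exact Or.inl (Or.inl h)
      · exact Or.inr h
  -- (c4) glue along the boundary layer
  have hunion : Bb ∪ box d (N + 1) = V := by
    ext x; rw [mem_union, hBb, mem_sdiff]
    constructor
    · rintro (⟨h, -⟩ | h)
      · exact h
      · exact box_mono d (by omega) h
    · intro hx
      by_cases h : x ∈ box d N
      · exact Or.inr (box_mono d (by omega) h)
      · exact Or.inl ⟨hx, h⟩
  have hL : Bb ∩ box d (N + 1) = bdry d N := by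
    ext x; rw [bdry, innerBoundary_box_succ, mem_inter, hBb, mem_sdiff, mem_sdiff]
    constructor
    · rintro ⟨⟨-, h⟩, h'⟩; exact ⟨h', h⟩
    · rintro ⟨h, h'⟩; exact ⟨⟨box_mono d (by omega) h, h'⟩, h⟩
  have hLne : (bdry d N).Nonempty := by
    set i : Fin d := ⟨0, hd1⟩
    refine ⟨fun j => if j = i then (N : ℤ) + 1 else 0, mem_innerBoundary_box.2 ⟨mem_box.2 fun j => ?_, i, ?_⟩⟩
    · show -((N + 1 : ℕ) : ℤ) ≤ (if j = i then (N : ℤ) + 1 else 0) ∧ (if j = i then (N : ℤ) + 1 else 0) ≤ ((N + 1 : ℕ) : ℤ)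
      split_ifs <;> omega
    · show (if i = i then (N : ℤ) + 1 else 0).natAbs = N + 1
      rw [if_pos rfl]; omega
  have hglue := ccount_union_add_one (R := wire R' Bb) (wire_symm hR's _) hL hLne (fun a ha haL b hb hbL => ?_)
    (fun a ha b hb => ReflTransGen.single ⟨Or.inr ⟨(mem_inter.1 (hL.symm ▸ ha : a ∈ Bb ∩ box d (N + 1))).1,
      (mem_inter.1 (hL.symm ▸ hb : b ∈ Bb ∩ box d (N + 1))).1⟩, (mem_inter.1 (hL.symm ▸ ha : a ∈ Bb ∩ box d (N + 1))).1,
      (mem_inter.1 (hL.symm ▸ hb : b ∈ Bb ∩ box d (N + 1))).1⟩)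
    (fun a ha b hb => ReflTransGen.single ⟨Or.inr ⟨(mem_inter.1 (hL.symm ▸ ha : a ∈ Bb ∩ box d (N + 1))).1,
      (mem_inter.1 (hL.symm ▸ hb : b ∈ Bb ∩ box d (N + 1))).1⟩, (mem_inter.1 (hL.symm ▸ ha : a ∈ Bb ∩ box d (N + 1))).2,
      (mem_inter.1 (hL.symm ▸ hb : b ∈ Bb ∩ box d (N + 1))).2⟩)
  swap
  · -- separation: `a ∈ V ∖ Λ_{N+1}`, `b ∈ Λ_N`
    have ha' : a ∉ box d (N + 1) := fun h => haL (hL ▸ mem_inter.2 ⟨ha, h⟩)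
    have hb' : b ∈ box d N := by
      by_contra h; exact hbL (by rw [bdry, innerBoundary_box_succ, mem_sdiff]; exact ⟨hb, h⟩)
    have hnadj : ¬ (zdGraph d).Adj a b := fun h => ha' (mem_box_succ_of_adj N h.symm hb')
    have hbBb : b ∉ Bb := fun h => (mem_sdiff.1 h).2 hb'
    constructor
    · rintro (h | ⟨-, h⟩)
      · exact hnadj h.1
      · exact hbBb h
    · rintro (h | ⟨h, -⟩)
      · exact hnadj h.1.symm
      · exact hbBb h
  rw [hunion] at hglue
  have hBb1 : ccount (wire R' Bb) Bb = 1 :=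
    ccount_eq_one (hLne.mono fun x hx => (mem_inter.1 (hL.symm ▸ hx : x ∈ Bb ∩ box d (N + 1))).1)
      fun a ha b hb => ReflTransGen.single ⟨Or.inr ⟨ha, hb⟩, ha, hb⟩
  -- (c5) on `Λ_{N+1}` the relation is the wired configuration relation
  have h5 : ccount (wire R' Bb) (box d (N + 1)) = ccount (wire (Rcfg ω) (bdry d N)) (box d (N + 1)) := by
    refine ccount_congr fun a ha b hb => ?_
    have hmemBb : ∀ x ∈ box d (N + 1), (x ∈ Bb ↔ x ∈ bdry d N) := fun x hx => by
      rw [bdry, innerBoundary_box_succ, mem_sdiff, mem_sdiff]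
      exact ⟨fun h => ⟨hx, h.2⟩, fun h => ⟨box_mono d (by omega) hx, h.2⟩⟩
    rw [wire, wire, hmemBb a ha, hmemBb b hb, hR', ROpen, Rcfg]
    constructor
    · rintro (⟨hab, ho⟩ | h)
      · by_cases hFe : s(a, b) ∈ F
        · exact Or.inl ⟨hab, (eOpen_iff_of_mem hFe).1 ho⟩
        · exact Or.inr (mem_bdry_of_not_mem_freeEdges N hab ha hb hFe)
      · exact Or.inr h
    · rintro (⟨hab, he⟩ | h)
      · exact Or.inl ⟨hab, (eOpen_iff_of_mem (hω he)).2 he⟩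
      · exact Or.inr h
  -- assemble
  have hpos : 0 < ccount (wire R' layer) V := ccount_pos ⟨0, zero_mem_box (d := d) _⟩
  change ccount (wire R' layer) V - 1 + 1 = _
  rw [Nat.sub_add_cancel hpos, h3, ← h5]
  omega

/-! ### The weight identity -/

/-- The edge parameter `p = t²/(1+t²)` of the random-cluster measure with `p/(1-p) = t²`. [cite: Grimmett2006, §1.2] -/
def pOf (t : ℝ) : ℝ := t ^ 2 / (1 + t ^ 2)

/-- `0 < p < 1` for `t > 0`. [folklore] -/
theorem pOf_mem (t : ℝ) (ht : 0 < t) : pOf t ∈ Set.Ioo (0 : ℝ) 1 := by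
  rw [pOf]
  constructor
  · positivity
  · rw [div_lt_one (by positivity)]; linarith

/-- `p/(1-p) = t²`. [folklore] -/
theorem pOf_div (t : ℝ) : pOf t / (1 - pOf t) = t ^ 2 := by
  have : (1 : ℝ) + t ^ 2 ≠ 0 := by positivity
  rw [pOf]; field_simp; ring

/-- `1 - p = 1/(1+t²)`. [folklore] -/
theorem one_sub_pOf (t : ℝ) : 1 - pOf t = 1 / (1 + t ^ 2) := by
  have : (1 : ℝ) + t ^ 2 ≠ 0 := by positivity
  rw [pOf]; field_simp; ring

/-- The Bernoulli factor: `p^a (1-p)^{E-a} = (1-p)^E (t²)^a` for `a ≤ E`. [folklore] -/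
theorem pow_mul_pow_eq (t : ℝ) {a E : ℕ} (h : a ≤ E) : pOf t ^ a * (1 - pOf t) ^ (E - a) = (1 - pOf t) ^ E * (t ^ 2) ^ a := by
  have h1 : 1 - pOf t ≠ 0 := by rw [one_sub_pOf]; positivity
  rw [← pOf_div, div_pow, ← mul_div_assoc, eq_div_iff (pow_ne_zero _ h1), mul_assoc, ← pow_add, Nat.sub_add_cancel h, mul_comm]

/-- **The weight identity**: for a configuration `ωb` of the wired box `Λ_{N+1}`, with `ω` its ambient
image and `F` the free edges of `Λ_{N+3}`,
`rcWeight(ωb) = C₀ · (t²)^{|ω ∖ F|} · wt^{ord}_{Λ_{N+3}}(ω ∩ F)` with an explicit positive constant `C₀`.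
[cite: FriedliVelenik2017, §7.3 (μ^#_Λ as the ensemble Ω^#_Λ); Grimmett2006, §4.2] -/
theorem rcWeight_wired_eq (hd1 : 1 ≤ d) {t q : ℝ} (ht : 0 < t) (hq : 0 < q) {ωb : Finset (Sym2 ↥(box d (N + 1)))}
    (hωb : ωb ⊆ (finsetGraph (zdGraph d) (box d (N + 1))).edgeFinset) :
    rcWeight (finsetGraph (zdGraph d) (box d (N + 1))) (pOf t) q (wiredBoundary (zdGraph d) (box d (N + 1))) ωb =
      ((1 - pOf t) ^ #(finsetGraph (zdGraph d) (box d (N + 1))).edgeFinset * q *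
        (t ^ pinned (box d (N + 3)))⁻¹) *
      (t ^ 2) ^ #(amb ωb \ freeEdges (box d (N + 3))) *
        wt t q Phase.ord (box d (N + 3)) (amb ωb ∩ freeEdges (box d (N + 3))) := by
  set E := (finsetGraph (zdGraph d) (box d (N + 1))).edgeFinset with hE
  set F := freeEdges (box d (N + 3)) with hF
  set ω := amb ωb with hω
  set cW := ∑ x ∈ box d (N + 3), #((nbrs x).filter fun y => s(x, y) ∉ F) with hcW
  have hcard : #ωb = #(ω ∩ F) + #(ω \ F) := by rw [← card_amb ωb]; exact (card_inter_add_card_sdiff _ _).symm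
  have hωF : ω ∩ F ⊆ F := inter_subset_right
  have hcc : clusterCount (↑ωb : Set (Sym2 ↥(box d (N + 1)))) (wiredBoundary (zdGraph d) (box d (N + 1))) =
      kappa Phase.ord (box d (N + 3)) F (ω ∩ F) + 1 := by
    rw [kappa_ord_box_add_one N hd1 hωF, ← ccount_wire_eq_inter N ω]
    exact clusterCount_eq_ccount hωb (bdry d N)
  rw [rcWeight, card_sdiff_of_subset hωb, pow_mul_pow_eq t (card_le_card hωb), hcc, wt, energy_ord_eq hωF, hcard, pow_add,
    pow_add, pow_add, pow_mul, pow_one]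
  have htc : t ^ cW ≠ 0 := pow_ne_zero _ ht.ne'
  field_simp
  ring

/-- **Sums of wired box weights over events depending on the free edges are ensemble sums.**
[cite: FriedliVelenik2017, §7.3] -/
theorem sum_rcWeight_wired_eq (hd1 : 1 ≤ d) {t q : ℝ} (ht : 0 < t) (hq : 0 < q) (P : Finset (Sym2 (Site d)) → Prop) [DecidablePred P]
    (hP : ∀ ω, P ω ↔ P (ω ∩ freeEdges (box d (N + 3)))) :
    ∑ ωb ∈ (finsetGraph (zdGraph d) (box d (N + 1))).edgeFinset.powerset,
        (if P (amb ωb) then rcWeight (finsetGraph (zdGraph d) (box d (N + 1))) (pOf t) q (wiredBoundary (zdGraph d) (box d (N + 1))) ωb else 0) =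
      ((1 - pOf t) ^ #(finsetGraph (zdGraph d) (box d (N + 1))).edgeFinset * q *
        (t ^ pinned (box d (N + 3)))⁻¹) *
      (∑ ω'' ∈ (nnEdges (box d (N + 1)) \ freeEdges (box d (N + 3))).powerset, (t ^ 2) ^ #ω'') *
        ∑ ω' ∈ (freeEdges (box d (N + 3))).powerset, (if P ω' then wt t q Phase.ord (box d (N + 3)) ω' else 0) := by
  set F := freeEdges (box d (N + 3)) with hF
  set C₀ := (1 - pOf t) ^ #(finsetGraph (zdGraph d) (box d (N + 1))).edgeFinset * q *
    (t ^ pinned (box d (N + 3)))⁻¹ with hC₀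
  have hFsub : F ⊆ nnEdges (box d (N + 1)) := freeEdges_box_subset_nnEdges N
  -- rewrite each summand, then pass to ambient configurations
  set g : Finset (Sym2 (Site d)) → ℝ := fun ω =>
    if P (ω ∩ F) then C₀ * (t ^ 2) ^ #(ω \ F) * wt t q Phase.ord (box d (N + 3)) (ω ∩ F) else 0 with hg
  have step1 : ∀ ωb ∈ (finsetGraph (zdGraph d) (box d (N + 1))).edgeFinset.powerset,
      (if P (amb ωb) then rcWeight (finsetGraph (zdGraph d) (box d (N + 1))) (pOf t) q (wiredBoundary (zdGraph d) (box d (N + 1))) ωb else 0) =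
        g (amb ωb) := by
    intro ωb hωb
    simp only [hg]
    by_cases h : P (amb ωb)
    · rw [if_pos h, if_pos ((hP _).1 h), rcWeight_wired_eq N hd1 ht hq (mem_powerset.1 hωb)]
    · rw [if_neg h, if_neg fun h' => h ((hP _).2 h')]
  rw [sum_congr rfl step1, sum_powerset_edgeFinset_eq g]
  conv_lhs => rw [show nnEdges (box d (N + 1)) = F ∪ (nnEdges (box d (N + 1)) \ F) from (union_sdiff_of_subset hFsub).symm,
    sum_powerset_union disjoint_sdiff]
  have step2 : ∀ a ∈ F.powerset, ∀ b ∈ (nnEdges (box d (N + 1)) \ F).powerset,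
      g (a ∪ b) = (t ^ 2) ^ #b * (C₀ * (if P a then wt t q Phase.ord (box d (N + 3)) a else 0)) := by
    intro a ha b hb
    simp only [hg]
    have ha' := mem_powerset.1 ha
    have hb' : Disjoint b F := Finset.disjoint_left.2 fun e he heF => (mem_sdiff.1 (mem_powerset.1 hb he)).2 heF
    have h1 : (a ∪ b) ∩ F = a := by
      rw [union_inter_distrib_right, inter_eq_left.2 ha', disjoint_iff_inter_eq_empty.1 hb', union_empty]
    have h2 : (a ∪ b) \ F = b := by
      rw [union_sdiff_distrib, sdiff_eq_empty_iff_subset.2 ha', empty_union, _root_.sdiff_eq_self_iff_disjoint.2 hb'.symm]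
    simp only [h1, h2]
    split_ifs <;> ring
  rw [sum_congr rfl fun a ha => (sum_congr rfl fun b hb => step2 a ha b hb).trans (sum_mul _ _ _).symm, ← mul_sum, ← mul_sum]
  ring

end Wired

/-! ### The probability identity and the connection event -/

section Prob

variable (N : ℕ)

/-- Dividing an indicator. [folklore] -/
theorem ite_div_eq (c : Prop) [Decidable c] (a Z : ℝ) : (if c then a / Z else 0) = (if c then a else 0) / Z := by
  split_ifs <;> simp

/-- **The wired box measure of an event depending only on the free edges is the ensemble
probability of the corresponding event.** [cite: FriedliVelenik2017, §7.3 (μ^#_Λ and Ω^#_Λ); Grimmett2006, §4.2] -/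
theorem real_rcMeasure_wired_eq_ensProb (hd1 : 1 ≤ d) {t q : ℝ} (ht : 0 < t) (hq : 0 < q) (P : Finset (Sym2 (Site d)) → Prop)
    [DecidablePred P] (hP : ∀ ω, P ω ↔ P (ω ∩ freeEdges (box d (N + 3)))) (A : Set (Percolation.BondConfig ↥(box d (N + 1))))
    [DecidablePred (· ∈ A)]
    (hA : ∀ ωb ⊆ (finsetGraph (zdGraph d) (box d (N + 1))).edgeFinset, ((↑ωb : Set (Sym2 ↥(box d (N + 1)))) ∈ A ↔ P (amb ωb))) :
    (rcMeasure (finsetGraph (zdGraph d) (box d (N + 1))) (pOf t) q (wiredBoundary (zdGraph d) (box d (N + 1)))).real A =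
      ensProb t q Phase.ord (box d (N + 3)) P := by
  classical
  have hp : pOf t ∈ Set.Icc (0 : ℝ) 1 := ⟨(pOf_mem t ht).1.le, (pOf_mem t ht).2.le⟩
  set G := finsetGraph (zdGraph d) (box d (N + 1))
  set B := wiredBoundary (zdGraph d) (box d (N + 1))
  have hterm : ∀ ωb ∈ G.edgeFinset.powerset,
      (if (↑ωb : Set (Sym2 ↥(box d (N + 1)))) ∈ A then rcWeight G (pOf t) q B ωb / rcPartitionFunction G (pOf t) q B else 0) =
        (if P (amb ωb) then rcWeight G (pOf t) q B ωb else 0) / rcPartitionFunction G (pOf t) q B := by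
    intro ωb hωb
    by_cases h : P (amb ωb)
    · rw [if_pos ((hA ωb (mem_powerset.1 hωb)).2 h), if_pos h]
    · rw [if_neg (fun h' => h ((hA ωb (mem_powerset.1 hωb)).1 h')), if_neg h, zero_div]
  rw [rcMeasure_real_apply G hp hq B A, sum_congr rfl hterm, ← sum_div]
  -- numerator and partition function
  have hnum := sum_rcWeight_wired_eq N hd1 ht hq P hP
  have hZ : rcPartitionFunction G (pOf t) q B =
      ((1 - pOf t) ^ #G.edgeFinset * q * (t ^ pinned (box d (N + 3)))⁻¹) *
        (∑ ω'' ∈ (nnEdges (box d (N + 1)) \ freeEdges (box d (N + 3))).powerset, (t ^ 2) ^ #ω'') * Zrc t q Phase.ord (box d (N + 3)) := by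
    have h := sum_rcWeight_wired_eq N hd1 ht hq (fun _ => True) (fun _ => Iff.rfl)
    simp only [ite_true] at h
    rw [rcPartitionFunction, h, Zrc_eq_sum_wt]
  -- the ugly-but-harmless rewriting of the `ite` with `P (amb ωb)` as an `=` of propositions is avoided:
  have hnum' : ∑ ωb ∈ G.edgeFinset.powerset, (if P (amb ωb) then rcWeight G (pOf t) q B ωb else 0) =
      ((1 - pOf t) ^ #G.edgeFinset * q * (t ^ pinned (box d (N + 3)))⁻¹) *
        (∑ ω'' ∈ (nnEdges (box d (N + 1)) \ freeEdges (box d (N + 3))).powerset, (t ^ 2) ^ #ω'') *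
          ∑ ω' ∈ (freeEdges (box d (N + 3))).powerset, (if P ω' then wt t q Phase.ord (box d (N + 3)) ω' else 0) := hnum
  have hC : (1 - pOf t) ^ #G.edgeFinset * q * (t ^ pinned (box d (N + 3)))⁻¹ *
      ∑ ω'' ∈ (nnEdges (box d (N + 1)) \ freeEdges (box d (N + 3))).powerset, (t ^ 2) ^ #ω'' ≠ 0 := by
    have h1 : 0 < 1 - pOf t := by linarith [(pOf_mem t ht).2]
    have h2 : 0 < ∑ ω'' ∈ (nnEdges (box d (N + 1)) \ freeEdges (box d (N + 3))).powerset, (t ^ 2) ^ #ω'' :=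
      sum_pos (fun _ _ => by positivity) ⟨∅, empty_mem_powerset _⟩
    exact mul_ne_zero (mul_ne_zero (mul_ne_zero (pow_ne_zero _ h1.ne') hq.ne') (inv_ne_zero (pow_ne_zero _ ht.ne'))) h2.ne'
  rw [ensProb_eq_sum_ite, hZ, sum_congr rfl fun ωb _ => (rfl : (if P (amb ωb) then rcWeight G (pOf t) q B ωb else 0) = _), hnum',
    mul_div_mul_left _ _ hC]

/-- **Reachability in the open graph of a box configuration is a chain of the ambient open relation.**
[cite: Grimmett2006, §1.2] -/
theorem reachable_openGraph_iff {Λ : Finset (Site d)} {ωb : Finset (Sym2 ↥Λ)} (hω : ωb ⊆ (finsetGraph (zdGraph d) Λ).edgeFinset) (x y : ↥Λ) :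
    (Percolation.openGraph (↑ωb : Set (Sym2 ↥Λ))).Reachable x y ↔ ReflTransGen (relIn (Rcfg (amb ωb)) Λ) x.1 y.1 := by
  have : Percolation.openGraph (↑ωb : Set (Sym2 ↥Λ)) = Percolation.openGraph (↑ωb : Set (Sym2 ↥Λ)) ⊔ wired {z : ↥Λ | z.1 ∈ (∅ : Finset (Site d))} := by
    rw [setOf_mem_empty, wired_empty, sup_bot_eq]
  rw [this, reachable_sup_wired_iff hω ∅]
  exact ⟨fun h => ClassCount.reflTransGen_mono (fun a _ b _ hab => hab.elim id fun h' => absurd h'.1 (notMem_empty a)) h,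
    fun h => ClassCount.reflTransGen_mono (fun a _ b _ hab => Or.inl hab) h⟩

/-- **The wired box probability of `0 ↔ ∂Λ_{N+1}` is the ensemble probability of the connection event.**
[cite: Grimmett2006, Prop. (5.11); FriedliVelenik2017, §7.3] -/
theorem real_rcMeasure_wired_origin (hd1 : 1 ≤ d) {t q : ℝ} (ht : 0 < t) (hq : 0 < q) [DecidablePred (Aev (d := d) N)]
    [DecidablePred fun ω : Percolation.BondConfig ↥(box d (N + 1)) =>
      ω ∈ {ω | ∃ y : ↥(box d (N + 1)), y.1 ∈ bdry d N ∧ (Percolation.openGraph ω).Reachable ⟨0, zero_mem_box (d := d) (N + 1)⟩ y}] :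
    (rcMeasure (finsetGraph (zdGraph d) (box d (N + 1))) (pOf t) q (wiredBoundary (zdGraph d) (box d (N + 1)))).real
        {ω | ∃ y : ↥(box d (N + 1)), y.1 ∈ bdry d N ∧ (Percolation.openGraph ω).Reachable ⟨0, zero_mem_box (d := d) (N + 1)⟩ y} =
      ensProb t q Phase.ord (box d (N + 3)) (Aev N) := by
  refine real_rcMeasure_wired_eq_ensProb N hd1 ht hq (Aev N) (fun ω => aev_iff_aev_inter N) _ fun ωb hωb => ?_
  simp only [Set.mem_setOf_eq, Aev]
  constructor
  · rintro ⟨y, hy, hr⟩; exact ⟨y.1, hy, (reachable_openGraph_iff hωb _ _).1 hr⟩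
  · rintro ⟨y, hy, hr⟩
    exact ⟨⟨y, innerBoundary_subset_self _ _ hy⟩, hy, (reachable_openGraph_iff hωb ⟨0, _⟩ ⟨y, _⟩).2 hr⟩
  where
    innerBoundary_subset_self (G : SimpleGraph (Site d)) [DecidableRel G.Adj] [G.LocallyFinite] (Λ : Finset (Site d)) :
        innerBoundary G Λ ⊆ Λ := filter_subset _ _

/-- **If the origin is not joined to `∂Λ_{N+1}`, it lies in the hull of an external contour of the
`ord`-ensemble** (the origin is then not in the exterior of all contours, whose sites are joined by open
edges to the outer layer). [cite: FriedliVelenik2017, §7.3, Lemma 7.23; Grimmett2006, §7.5] -/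
theorem exists_hull_of_not_aev (hd : 2 ≤ d) {ω : Finset (Sym2 (Site d))} (hω : ω ⊆ freeEdges (box d (N + 3))) (hno : ¬ Aev N ω) :
    ∃ γ ∈ extContours Phase.ord hω, (0 : Site d) ∈ (rcSetup d).hull γ := by
  classical
  by_contra hcon
  push Not at hcon
  have h0 : (0 : Site d) ∈ Vext Phase.ord (box d (N + 3)) hω := mem_filter.2 ⟨zero_mem_box (d := d) _, hcon⟩
  obtain ⟨b, hb, hchain⟩ := exists_chain_to_layer_of_mem_Vext hd hω h0
  -- `b` is outside `Λ_{N+2}`, in particular outside `Λ_N`; first exit from `Λ_N`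
  have hbN : b ∉ box d N := fun h => by
    rw [show N + 3 = (N + 2) + 1 from rfl, inner1_box, mem_sdiff] at hb
    exact hb.2 (box_mono d (by omega) h)
  have hno' : ¬ ReflTransGen (relIn (ROpen Phase.ord (freeEdges (box d (N + 3))) ω) (box d (N + 3) ∩ box d N)) 0 b := fun h' =>
    hbN (mem_inter.1 (ClassCount.mem_of_reflTransGen h' (mem_inter.2 ⟨zero_mem_box (d := d) _, zero_mem_box (d := d) _⟩))).2
  obtain ⟨p, v, hp, hv, hpv, h0p, -⟩ := ClassCount.exists_first_exit hchain (zero_mem_box (d := d) N) hno'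
  refine hno ⟨v, ?_, ?_⟩
  · rw [bdry, innerBoundary_box_succ, mem_sdiff]; exact ⟨mem_box_succ_of_adj N hpv.1.1 hp, hv⟩
  · have hstep : ∀ {a b' : Site d}, a ∈ box d N → ROpen Phase.ord (freeEdges (box d (N + 3))) ω a b' → Rcfg ω a b' :=
      fun ha hab => ⟨hab.1, (eOpen_iff_of_mem (mk_mem_freeEdges_of_mem N hab.1 (Or.inl ha))).1 hab.2⟩
    have h1 : ReflTransGen (relIn (Rcfg ω) (box d (N + 1))) 0 p := by
      refine ClassCount.reflTransGen_of_subset (fun x hx => box_mono d (by omega) (mem_inter.1 hx).2)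
        (ClassCount.reflTransGen_mono (fun a ha b' _ hab => hstep (mem_inter.1 ha).2 hab) h0p)
    exact h1.tail ⟨hstep hp hpv.1, box_mono d (by omega) hp, mem_box_succ_of_adj N hpv.1.1 hp⟩

/-- **`1 - θ¹`-type bound**: the ensemble probability that the origin is not joined to `∂Λ_{N+1}` is
at most the ensemble probability that the origin lies in the hull of an external contour.
[cite: Grimmett2006, §7.5 (proof of Thm. 7.33, wired part); FriedliVelenik2017, §7.3] -/
theorem ensProb_not_aev_le (hd : 2 ≤ d) {t q : ℝ} (ht : 0 < t) (hq : 0 < q) [DecidablePred (Aev (d := d) N)]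
    [DecidablePred fun ω : Finset (Sym2 (Site d)) => ∃ γ ∈ xc Phase.ord (box d (N + 3)) ω, (0 : Site d) ∈ (rcSetup d).hull γ] :
    ensProb t q Phase.ord (box d (N + 3)) (fun ω => ¬ Aev N ω) ≤
      ensProb t q Phase.ord (box d (N + 3)) (fun ω => ∃ γ ∈ xc Phase.ord (box d (N + 3)) ω, (0 : Site d) ∈ (rcSetup d).hull γ) := by
  refine ensProb_mono ht hq fun ω hω hno => ?_
  obtain ⟨γ, hγ, h0⟩ := exists_hull_of_not_aev N hd hω hno
  exact ⟨γ, by rw [xc_eq hω]; exact hγ, h0⟩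

/-- Complementary events have complementary ensemble probabilities. [folklore] -/
theorem ensProb_not {t q : ℝ} (ht : 0 < t) (hq : 0 < q) (σ : Phase) (V : Finset (Site d)) (P : Finset (Sym2 (Site d)) → Prop)
    [DecidablePred P] : ensProb t q σ V (fun ω => ¬ P ω) = 1 - ensProb t q σ V P := by
  rw [ensProb, ensProb, eq_sub_iff_add_eq, ← add_div, div_eq_one_iff_eq (Zrc_pos ht hq σ V).ne', Zrc_eq_sum_wt, filter_not,
    sum_sdiff_eq_sub (filter_subset _ _), sub_add_cancel]

end Prob





/-! ## Part 2: free boxes -/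


/-! ### The free volume setting -/

section Free

variable (N : ℕ)

/-- In the `dis` phase an edge is open iff it belongs to the configuration. [folklore] -/
theorem eOpen_dis_iff (F ω : Finset (Sym2 (Site d))) (e : Sym2 (Site d)) : EOpen Phase.dis F ω e ↔ e ∈ ω := by
  unfold EOpen
  constructor
  · rintro (h | ⟨-, h⟩)
    · exact h
    · exact absurd h (by decide)
  · exact Or.inl

/-- The cluster functional of a `dis`-volume configuration is the class count of its open relation.
[cite: Grimmett2006, §7.5] -/
theorem kappa_dis_eq (V : Finset (Site d)) (ω : Finset (Sym2 (Site d))) :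
    kappa Phase.dis V (freeEdges V) ω = ccount (Rcfg ω) V := by
  change ccount (ROpen Phase.dis (freeEdges V) ω) V = _
  exact ccount_congr fun a _ b _ => by rw [ROpen, Rcfg, eOpen_dis_iff]

/-- Edges inside `Λ_N` are free in `Λ_{N+3}`. [folklore] -/
theorem nnEdges_subset_freeEdges : nnEdges (box d N) ⊆ freeEdges (box d (N + 3)) := fun e he => by
  obtain ⟨heE, hmem⟩ := mem_nnEdges.1 he
  induction e using Sym2.ind with
  | h a b => exact mem_freeEdges_box.2 ⟨heE, a, Sym2.mem_mk_left a b, hmem a (Sym2.mem_mk_left a b)⟩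

/-- **A point outside `Λ_N` has at most one lattice neighbour in `Λ_N`.** [folklore] -/
theorem nbr_in_box_unique {v u u' : Site d} (hv : v ∉ box d N) (hu : u ∈ box d N) (hu' : u' ∈ box d N)
    (hvu : (zdGraph d).Adj v u) (hvu' : (zdGraph d).Adj v u') : u = u' := by
  rw [mem_box, not_forall] at hv
  obtain ⟨i, hi⟩ := hv
  have hui := (mem_box.1 hu) i
  have hu'i := (mem_box.1 hu') i
  -- a neighbour of `v` in `Λ_N` differs from `v` exactly at `i`, in the inward direction
  have key : ∀ {w : Site d}, w ∈ box d N → (zdGraph d).Adj v w → w = Function.update v i (if 0 ≤ v i then v i - 1 else v i + 1) := by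
    intro w hw hvw
    have hwi := (mem_box.1 hw) i
    obtain ⟨j, hj⟩ := (zdGraph_adj_iff v w).1 hvw
    have hwv : ∀ k, k ≠ j → w k = v k := fun k hk => by
      rcases hj with rfl | h
      · simp [Pi.single_eq_of_ne hk]
      · have := congrFun h k; simp [Pi.single_eq_of_ne hk] at this; exact this.symm
    have hji : j = i := by
      by_contra hji; have := hwv i (Ne.symm hji); omega
    subst hji
    have hwj : w j = v j + 1 ∨ w j = v j - 1 := by
      rcases hj with rfl | h
      · left; simp
      · right; have := congrFun h j; simp at this; omega
    funext k
    by_cases hk : k = j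
    · subst hk; rw [Function.update_self]; split_ifs <;> omega
    · rw [Function.update_of_ne hk]; exact hwv k hk
  rw [key hu hvu, key hu' hvu']

/-- A pendant free edge has exactly one endpoint in `Λ_N`. [folklore] -/
theorem pendant_endpoints {e : Sym2 (Site d)} (he : e ∈ freeEdges (box d (N + 3))) (hne : e ∉ nnEdges (box d N)) :
    ∃ u v, e = s(u, v) ∧ u ∈ box d N ∧ v ∉ box d N ∧ v ∈ box d (N + 3) ∧ (zdGraph d).Adj u v := by
  obtain ⟨heE, z, hz, hzN⟩ := mem_freeEdges_box.1 he
  have heV := mem_nnEdges.1 (mem_filter.1 he).1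
  induction e using Sym2.ind with
  | h a b =>
    have hab := (SimpleGraph.mem_edgeSet _).1 heE
    have hnot : ¬ (a ∈ box d N ∧ b ∈ box d N) := fun h => hne (mk_mem_nnEdges.2 ⟨hab, h.1, h.2⟩)
    rcases Sym2.mem_iff.1 hz with rfl | rfl
    · exact ⟨z, b, rfl, hzN, fun hb => hnot ⟨hzN, hb⟩, heV.2 b (Sym2.mem_mk_right z b), hab⟩
    · exact ⟨z, a, Sym2.eq_swap, hzN, fun ha => hnot ⟨ha, hzN⟩, heV.2 a (Sym2.mem_mk_left a z), hab.symm⟩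

/-- **The pendant accounting**: for `ω ⊆ freeEdges Λ_{N+3}`,
`ccount (Rcfg ω) Λ_{N+3} + |ω ∖ E_{Λ_N}| = ccount (Rcfg (ω ∩ E_{Λ_N})) Λ_N + |Λ_{N+3} ∖ Λ_N|`.
[cite: Grimmett2006, §4.2 (free boundary condition; pendant edges)] -/
theorem ccount_free_pendant {ω : Finset (Sym2 (Site d))} (hω : ω ⊆ freeEdges (box d (N + 3))) :
    ccount (Rcfg ω) (box d (N + 3)) + #(ω \ nnEdges (box d N)) = ccount (Rcfg (ω ∩ nnEdges (box d N))) (box d N) + #(box d (N + 3) \ box d N) := by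
  classical
  set Λ := box d N with hΛ
  set V := box d (N + 3) with hV
  set ωp := ω \ nnEdges Λ with hωp
  set ωΛ := ω ∩ nnEdges Λ with hωΛ
  have hR : ∀ a b, Rcfg ω a b → Rcfg ω b a := rcfg_symm ω
  have hΛV : Λ ⊆ V := box_mono d (by omega)
  -- invariant over subsets `S` of the outer vertices
  have key : ∀ S : Finset (Site d), S ⊆ V \ Λ →
      ccount (Rcfg ω) (Λ ∪ S) + #(ωp.filter fun e => ∃ z, z ∈ e ∧ z ∈ S) = ccount (Rcfg ωΛ) Λ + #S := by
    intro S
    induction S using Finset.induction_on with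
    | empty =>
      intro _
      rw [union_empty, card_empty, add_zero, filter_false_of_mem fun e _ => by simp, card_empty, add_zero]
      refine ccount_congr fun a ha b hb => ?_
      rw [Rcfg, Rcfg, hωΛ, mem_inter]
      exact ⟨fun ⟨hab, he⟩ => ⟨hab, he, mk_mem_nnEdges.2 ⟨hab, ha, hb⟩⟩, fun ⟨hab, he, _⟩ => ⟨hab, he⟩⟩
    | insert v S hvS ih =>
      intro hsub
      have hS : S ⊆ V \ Λ := (subset_insert _ _).trans hsub
      obtain ⟨hvV, hvΛ⟩ := mem_sdiff.1 (hsub (mem_insert_self _ _))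
      set U := Λ ∪ S with hU
      have hvU : v ∉ U := fun h => (mem_union.1 h).elim hvΛ hvS
      have ih' := ih hS
      -- the pendant edges at `v`
      set pv := ωp.filter fun e => v ∈ e with hpv
      have hfilter : ωp.filter (fun e => ∃ z, z ∈ e ∧ z ∈ insert v S) = (ωp.filter fun e => ∃ z, z ∈ e ∧ z ∈ S) ∪ pv := by
        ext e; simp only [mem_filter, mem_union, mem_insert, hpv]
        constructor
        · rintro ⟨he, z, hz, rfl | hzS⟩
          · exact Or.inr ⟨he, hz⟩
          · exact Or.inl ⟨he, z, hz, hzS⟩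
        · rintro (⟨he, z, hz, hzS⟩ | ⟨he, hz⟩)
          · exact ⟨he, z, hz, Or.inr hzS⟩
          · exact ⟨he, v, hz, Or.inl rfl⟩
      have hpvdisj : Disjoint (ωp.filter fun e => ∃ z, z ∈ e ∧ z ∈ S) pv := by
        rw [Finset.disjoint_left]
        intro e he he'
        obtain ⟨heωp, z, hz, hzS⟩ := mem_filter.1 he
        obtain ⟨-, hve⟩ := mem_filter.1 he'
        obtain ⟨heω, hene⟩ := mem_sdiff.1 heωp
        obtain ⟨u, w, rfl, hu, hw, -, huw⟩ := pendant_endpoints N (hω heω) hene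
        -- the endpoints are `u ∈ Λ` and `w`; `v ∈ e` forces `w = v`, then `z ∈ S` forces `z = u ∈ Λ`: contradiction
        have hwv : w = v := by
          rcases Sym2.mem_iff.1 hve with rfl | rfl
          · exact absurd hu hvΛ
          · rfl
        subst hwv
        rcases Sym2.mem_iff.1 hz with rfl | rfl
        · exact (mem_sdiff.1 (hS hzS)).2 hu
        · exact hvS hzS
      -- open edges at `v` towards `U` are pendant edges at `v`
      have hedge : ∀ {a}, a ∈ U → Rcfg ω a v → s(a, v) ∈ pv := fun {a} ha hav => by
        refine mem_filter.2 ⟨mem_sdiff.2 ⟨hav.2, fun h => hvΛ (mk_mem_nnEdges.1 h).2.2⟩, Sym2.mem_mk_right a v⟩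
      rw [hfilter, card_union_of_disjoint hpvdisj, card_insert_of_notMem hvS,
        show Λ ∪ insert v S = U ∪ {v} from by rw [hU, insert_eq, union_comm {v} S, union_assoc]]
      by_cases hpv0 : pv = ∅
      · -- `v` is isolated from `U`
        have hsep : ∀ a ∈ U, ∀ b ∈ ({v} : Finset (Site d)), ¬ Rcfg ω a b ∧ ¬ Rcfg ω b a := by
          intro a ha b hb
          rw [mem_singleton] at hb; subst hb
          exact ⟨fun h => by have := hedge ha h; rw [hpv0] at this; exact notMem_empty _ this,
            fun h => by have := hedge ha (hR _ _ h); rw [hpv0] at this; exact notMem_empty _ this⟩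
        rw [ccount_union_of_separated hsep (disjoint_singleton_right.2 hvU), hpv0, card_empty,
          ccount_eq_one (singleton_nonempty v) fun a ha b hb => by
            rw [mem_singleton] at ha hb; subst ha; subst hb; exact ReflTransGen.refl]
        omega
      · -- one pendant edge `e₀ = vu`, `u ∈ Λ`: glue `{u, v}` along `{u}`
        obtain ⟨e₀, he₀⟩ := nonempty_iff_ne_empty.2 hpv0
        obtain ⟨he₀ωp, hve₀⟩ := mem_filter.1 he₀
        obtain ⟨he₀ω, he₀ne⟩ := mem_sdiff.1 he₀ωp
        obtain ⟨u, w, he₀eq, hu, hw, -, huw⟩ := pendant_endpoints N (hω he₀ω) he₀ne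
        have hwv : w = v := by
          rw [he₀eq] at hve₀
          rcases Sym2.mem_iff.1 hve₀ with rfl | rfl
          · exact absurd hu hvΛ
          · rfl
        subst hwv
        have hpv1 : pv = {s(u, w)} := by
          refine eq_singleton_iff_unique_mem.2 ⟨he₀eq ▸ he₀, fun e he => ?_⟩
          obtain ⟨heωp, hve⟩ := mem_filter.1 he
          obtain ⟨heω, hene⟩ := mem_sdiff.1 heωp
          obtain ⟨u', w', rfl, hu', hw', -, huw'⟩ := pendant_endpoints N (hω heω) hene
          have : w' = w := by
            rcases Sym2.mem_iff.1 hve with rfl | rfl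
            · exact absurd hu' hvΛ
            · rfl
          subst this
          rw [nbr_in_box_unique N hw' hu' hu huw'.symm huw.symm]
        have huU : u ∈ U := mem_union_left _ hu
        have hUuw : U ∪ {w} = U ∪ {u, w} := by
          rw [insert_eq, ← union_assoc, union_eq_left.2 (singleton_subset_iff.2 huU)]
        have hL : U ∩ {u, w} = {u} := by
          ext x; rw [mem_inter, mem_insert, mem_singleton, mem_singleton]
          constructor
          · rintro ⟨hx, rfl | rfl⟩
            · rfl
            · exact absurd hx hvU
          · rintro rfl; exact ⟨huU, Or.inl rfl⟩
        have hglue := ccount_union_add_one hR hL (singleton_nonempty u)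
          (fun a ha haL b hb hbL => ?_) (fun a ha b hb => ?_) (fun a ha b hb => ?_)
        · have h2 : ccount (Rcfg ω) {u, w} = 1 := by
            refine ccount_eq_one ⟨u, mem_insert_self _ _⟩ fun a ha b hb => ?_
            have huw' : Rcfg ω u w := ⟨huw, he₀eq ▸ he₀ω⟩
            have step : ∀ {x y}, x ∈ ({u, w} : Finset (Site d)) → y ∈ ({u, w} : Finset (Site d)) → x ≠ y →
                ReflTransGen (relIn (Rcfg ω) {u, w}) x y := by
              intro x y hx hy hxy
              rw [mem_insert, mem_singleton] at hx hy
              rcases hx with rfl | rfl <;> rcases hy with rfl | rfl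
              · exact absurd rfl hxy
              · exact ReflTransGen.single ⟨huw', mem_insert_self _ _, mem_insert_of_mem (mem_singleton_self _)⟩
              · exact ReflTransGen.single ⟨hR _ _ huw', mem_insert_of_mem (mem_singleton_self _), mem_insert_self _ _⟩
              · exact absurd rfl hxy
            by_cases hab : a = b
            · subst hab; exact ReflTransGen.refl
            · exact step ha hb hab
          rw [hUuw, hpv1, card_singleton]
          omega
        · -- separation
          rw [mem_singleton] at haL
          rw [mem_insert, mem_singleton] at hb
          rcases hb with rfl | rfl
          · exact absurd (mem_singleton_self _) hbL
          · constructor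
            · intro h
              have := hedge ha h
              rw [hpv1, mem_singleton, Sym2.eq_iff] at this
              rcases this with ⟨h1, -⟩ | ⟨h1, -⟩
              · exact haL h1
              · exact hvU (h1 ▸ ha)
            · intro h
              have := hedge ha (hR _ _ h)
              rw [hpv1, mem_singleton, Sym2.eq_iff] at this
              rcases this with ⟨h1, -⟩ | ⟨h1, -⟩
              · exact haL h1
              · exact hvU (h1 ▸ ha)
        · rw [mem_singleton] at ha hb; subst ha; subst hb; exact ReflTransGen.refl
        · rw [mem_singleton] at ha hb; subst ha; subst hb; exact ReflTransGen.refl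
  have hfinal := key (V \ Λ) Subset.rfl
  rw [union_sdiff_of_subset hΛV, filter_true_of_mem fun e he => ?_] at hfinal
  · exact hfinal
  · obtain ⟨heω, hene⟩ := mem_sdiff.1 he
    obtain ⟨u, v, rfl, -, hv, hvV, -⟩ := pendant_endpoints N (hω heω) hene
    exact ⟨v, Sym2.mem_mk_right u v, mem_sdiff.2 ⟨hvV, hv⟩⟩

/-! ### The free weight identity -/

/-- The pendant free edges of `Λ_{N+3}` relative to `Λ_N`. [cite: Grimmett2006, §4.2] -/
abbrev pendants (d N : ℕ) : Finset (Sym2 (Site d)) := freeEdges (box d (N + 3)) \ nnEdges (box d N)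

/-- The free edges split into the edges of `Λ_N` and the pendants. [folklore] -/
theorem freeEdges_eq_union : freeEdges (box d (N + 3)) = nnEdges (box d N) ∪ pendants d N :=
  (union_sdiff_of_subset (nnEdges_subset_freeEdges N)).symm

/-- **The free weight identity**: for a configuration `ωb` of `Λ_N` and pendant edges `ωp`,
`wt^{dis}_{Λ_{N+3}}(amb ωb ∪ ωp) = rcWeight⁰(ωb) · (1-p)^{-|E|} · q^{|Λ_{N+3} ∖ Λ_N|} · (t²/q)^{|ωp|}`.
[cite: Grimmett2006, §4.2 (pendant edges); FriedliVelenik2017, §7.3] -/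
theorem cfgWt_free_eq {t q : ℝ} (ht : 0 < t) (hq : 0 < q) {ωb : Finset (Sym2 ↥(box d N))}
    (hωb : ωb ⊆ (finsetGraph (zdGraph d) (box d N)).edgeFinset) {ωp : Finset (Sym2 (Site d))} (hωp : ωp ⊆ pendants d N) :
    wt t q Phase.dis (box d (N + 3)) (amb ωb ∪ ωp) =
      rcWeight (finsetGraph (zdGraph d) (box d N)) (pOf t) q ∅ ωb * ((1 - pOf t) ^ #(finsetGraph (zdGraph d) (box d N)).edgeFinset)⁻¹ *
        q ^ #(box d (N + 3) \ box d N) * (t ^ 2 / q) ^ #ωp := by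
  set E := (finsetGraph (zdGraph d) (box d N)).edgeFinset with hE
  set ω := amb ωb ∪ ωp with hω
  have hambE : amb ωb ⊆ nnEdges (box d N) := amb_subset_nnEdges hωb
  have hdisj : Disjoint (amb ωb) ωp := Finset.disjoint_left.2 fun e he he' => (mem_sdiff.1 (hωp he')).2 (hambE he)
  have hωF : ω ⊆ freeEdges (box d (N + 3)) :=
    union_subset (hambE.trans (nnEdges_subset_freeEdges N)) (hωp.trans sdiff_subset)
  have hωΛ : ω ∩ nnEdges (box d N) = amb ωb := by
    rw [hω, union_inter_distrib_right, inter_eq_left.2 hambE,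
      disjoint_iff_inter_eq_empty.1 (Finset.disjoint_left.2 fun e he he' => (mem_sdiff.1 (hωp he)).2 he'), union_empty]
  have hωp' : ω \ nnEdges (box d N) = ωp := by
    rw [hω, union_sdiff_distrib, sdiff_eq_empty_iff_subset.2 hambE, empty_union,
      _root_.sdiff_eq_self_iff_disjoint.2 (Finset.disjoint_left.2 fun e he' he => (mem_sdiff.1 (hωp he)).2 he')]
  have hcc := ccount_free_pendant N hωF
  rw [hωΛ, hωp'] at hcc
  have hk : clusterCount (↑ωb : Set (Sym2 ↥(box d N))) (∅ : Set ↥(box d N)) = ccount (Rcfg (amb ωb)) (box d N) :=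
    clusterCount_empty_eq_ccount hωb
  have h1p : 1 - pOf t ≠ 0 := by rw [one_sub_pOf]; positivity
  rw [wt, energy_dis_eq hωF, kappa_dis_eq, rcWeight, card_sdiff_of_subset hωb, pow_mul_pow_eq t (card_le_card hωb), hk,
    hω, card_union_of_disjoint hdisj, card_amb]
  -- `q^{ccount V} = q^{ccount Λ} q^{|W|} / q^{|ωp|}`
  have hq' : (q : ℝ) ^ ccount (Rcfg (amb ωb ∪ ωp)) (box d (N + 3)) = q ^ ccount (Rcfg (amb ωb)) (box d N) * q ^ #(box d (N + 3) \ box d N) / q ^ #ωp := by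
    rw [eq_div_iff (pow_ne_zero _ hq.ne'), ← pow_add, ← pow_add, hcc]
  rw [hq', pow_mul, pow_add, div_pow]
  field_simp

/-- **Sums of free box weights over events of `E_Λ` are `dis`-ensemble sums.** [cite: Grimmett2006, §4.2; FriedliVelenik2017, §7.3] -/
theorem sum_cfgWt_free_eq {t q : ℝ} (ht : 0 < t) (hq : 0 < q) (P : Finset (Sym2 (Site d)) → Prop) [DecidablePred P]
    (hP : ∀ ω, P ω ↔ P (ω ∩ nnEdges (box d N))) :
    ∑ ω ∈ (freeEdges (box d (N + 3))).powerset, (if P ω then wt t q Phase.dis (box d (N + 3)) ω else 0) =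
      (((1 - pOf t) ^ #(finsetGraph (zdGraph d) (box d N)).edgeFinset)⁻¹ * q ^ #(box d (N + 3) \ box d N) *
        ∑ ωp ∈ (pendants d N).powerset, (t ^ 2 / q) ^ #ωp) *
      ∑ ωb ∈ (finsetGraph (zdGraph d) (box d N)).edgeFinset.powerset,
        (if P (amb ωb) then rcWeight (finsetGraph (zdGraph d) (box d N)) (pOf t) q ∅ ωb else 0) := by
  set C := ((1 - pOf t) ^ #(finsetGraph (zdGraph d) (box d N)).edgeFinset)⁻¹ * q ^ #(box d (N + 3) \ box d N) with hC
  conv_lhs => rw [freeEdges_eq_union N, sum_powerset_union disjoint_sdiff]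
  -- pass to box configurations on the outer sum
  set g : Finset (Sym2 (Site d)) → ℝ := fun a => ∑ b ∈ (pendants d N).powerset,
    (if P (a ∪ b) then wt t q Phase.dis (box d (N + 3)) (a ∪ b) else 0) with hg
  rw [show ∑ a ∈ (nnEdges (box d N)).powerset, ∑ b ∈ (pendants d N).powerset,
      (if P (a ∪ b) then wt t q Phase.dis (box d (N + 3)) (a ∪ b) else 0) = ∑ a ∈ (nnEdges (box d N)).powerset, g a from rfl,
    ← sum_powerset_edgeFinset_eq g, mul_sum]
  refine sum_congr rfl fun ωb hωb => ?_
  have hωb := mem_powerset.1 hωb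
  simp only [hg]
  have hPab : ∀ b ∈ (pendants d N).powerset, (P (amb ωb ∪ b) ↔ P (amb ωb)) := fun b hb => by
    rw [hP, hP (amb ωb), union_inter_distrib_right, inter_eq_left.2 (amb_subset_nnEdges hωb),
      disjoint_iff_inter_eq_empty.1 (Finset.disjoint_left.2 fun e he he' => (mem_sdiff.1 (mem_powerset.1 hb he)).2 he'), union_empty]
  by_cases hPa : P (amb ωb)
  · rw [if_pos hPa, sum_congr rfl fun b hb => by rw [if_pos ((hPab b hb).2 hPa), cfgWt_free_eq N ht hq hωb (mem_powerset.1 hb)], ← mul_sum]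
    ring
  · rw [if_neg hPa, sum_congr rfl fun b hb => by rw [if_neg fun h => hPa ((hPab b hb).1 h)], sum_const_zero, mul_zero]

/-- **The free box measure of an event of `E_Λ` is the `dis`-ensemble probability of the corresponding
event.** [cite: Grimmett2006, §4.2; FriedliVelenik2017, §7.3] -/
theorem real_rcMeasure_free_eq_ensProb {t q : ℝ} (ht : 0 < t) (hq : 0 < q) (P : Finset (Sym2 (Site d)) → Prop) [DecidablePred P]
    (hP : ∀ ω, P ω ↔ P (ω ∩ nnEdges (box d N))) (A : Set (Percolation.BondConfig ↥(box d N))) [DecidablePred (· ∈ A)]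
    (hA : ∀ ωb ⊆ (finsetGraph (zdGraph d) (box d N)).edgeFinset, ((↑ωb : Set (Sym2 ↥(box d N))) ∈ A ↔ P (amb ωb))) :
    (rcMeasure (finsetGraph (zdGraph d) (box d N)) (pOf t) q ∅).real A = ensProb t q Phase.dis (box d (N + 3)) P := by
  classical
  have hp : pOf t ∈ Set.Icc (0 : ℝ) 1 := ⟨(pOf_mem t ht).1.le, (pOf_mem t ht).2.le⟩
  set G := finsetGraph (zdGraph d) (box d N)
  have hterm : ∀ ωb ∈ G.edgeFinset.powerset,
      (if (↑ωb : Set (Sym2 ↥(box d N))) ∈ A then rcWeight G (pOf t) q ∅ ωb / rcPartitionFunction G (pOf t) q ∅ else 0) =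
        (if P (amb ωb) then rcWeight G (pOf t) q ∅ ωb else 0) / rcPartitionFunction G (pOf t) q ∅ := by
    intro ωb hωb
    by_cases h : P (amb ωb)
    · rw [if_pos ((hA ωb (mem_powerset.1 hωb)).2 h), if_pos h]
    · rw [if_neg (fun h' => h ((hA ωb (mem_powerset.1 hωb)).1 h')), if_neg h, zero_div]
  rw [rcMeasure_real_apply G hp hq ∅ A, sum_congr rfl hterm, ← sum_div]
  have hnum := sum_cfgWt_free_eq N ht hq P hP
  have hZ : Zrc t q Phase.dis (box d (N + 3)) = (((1 - pOf t) ^ #G.edgeFinset)⁻¹ * q ^ #(box d (N + 3) \ box d N) *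
      ∑ ωp ∈ (pendants d N).powerset, (t ^ 2 / q) ^ #ωp) * rcPartitionFunction G (pOf t) q ∅ := by
    have h := sum_cfgWt_free_eq (d := d) N ht hq (fun _ => True) (fun _ => Iff.rfl)
    simp only [ite_true] at h
    rw [Zrc_eq_sum_wt, h, rcPartitionFunction]
  have hC : ((1 - pOf t) ^ #G.edgeFinset)⁻¹ * q ^ #(box d (N + 3) \ box d N) * ∑ ωp ∈ (pendants d N).powerset, (t ^ 2 / q) ^ #ωp ≠ 0 := by
    have h1 : 0 < 1 - pOf t := by linarith [(pOf_mem t ht).2]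
    have h2 : 0 < ∑ ωp ∈ (pendants d N).powerset, (t ^ 2 / q) ^ #ωp := sum_pos (fun _ _ => by positivity) ⟨∅, empty_mem_powerset _⟩
    exact mul_ne_zero (mul_ne_zero (inv_ne_zero (pow_ne_zero _ h1.ne')) (pow_ne_zero _ hq.ne')) h2.ne'
  rw [ensProb_eq_sum_ite, hnum, hZ, mul_div_mul_left _ _ hC]

/-! ### The connection event of a smaller box -/

/-- The event `0 ↔ ∂Λ_m` inside `Λ_m`, for an ambient configuration. [cite: Grimmett2006, Prop. (5.11)] -/
def Pm (m : ℕ) (ω : Finset (Sym2 (Site d))) : Prop :=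
  ∃ y ∈ innerBoundary (zdGraph d) (box d m), ReflTransGen (relIn (Rcfg ω) (box d m)) 0 y

/-- `Pm` only depends on the edges inside `Λ_m`. [folklore] -/
theorem pm_iff_pm_inter {m : ℕ} {Λ : Finset (Site d)} (h : box d m ⊆ Λ) (ω : Finset (Sym2 (Site d))) :
    Pm m ω ↔ Pm m (ω ∩ nnEdges Λ) := by
  refine exists_congr fun y => and_congr_right fun _ => ⟨fun hc => ?_, fun hc => ?_⟩
  · exact ClassCount.reflTransGen_mono (fun a ha b hb hab => ⟨hab.1, mem_inter.2 ⟨hab.2, mk_mem_nnEdges.2 ⟨hab.1, h ha, h hb⟩⟩⟩) hc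
  · exact ClassCount.reflTransGen_mono (fun a _ b _ hab => ⟨hab.1, (mem_inter.1 hab.2).1⟩) hc

/-- The restriction of a box configuration to a smaller box, as a finset of edges of the smaller box. [folklore] -/
def restrictBox {m N : ℕ} (h : box d m ⊆ box d N) (ωb : Finset (Sym2 ↥(box d N))) : Finset (Sym2 ↥(box d m)) :=
  (finsetGraph (zdGraph d) (box d m)).edgeFinset.filter fun e => edgeLift h e ∈ ωb

/-- The tree's restriction is the coercion of `restrictBox`. [folklore] -/
theorem finsetRestrict_coe_eq {m N : ℕ} (h : box d m ⊆ box d N) {ωb : Finset (Sym2 ↥(box d N))}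
    (hωb : ωb ⊆ (finsetGraph (zdGraph d) (box d N)).edgeFinset) :
    finsetRestrict h (↑ωb : Set (Sym2 ↥(box d N))) = ↑(restrictBox h ωb) := by
  ext e
  rw [mem_finsetRestrict_iff, mem_coe, mem_coe, restrictBox, mem_filter]
  refine ⟨fun he => ⟨?_, he⟩, fun he => he.2⟩
  induction e using Sym2.ind with
  | h x y =>
    rw [edgeLift_mk] at he
    exact mem_edgeFinset.2 ((SimpleGraph.mem_edgeSet _).2 ((adj_finsetIncl_iff h x y).1
      ((SimpleGraph.mem_edgeSet _).1 (mem_edgeFinset.1 (hωb he)))))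

/-- The ambient image of the restriction is the part inside the smaller box. [folklore] -/
theorem amb_restrictBox {m N : ℕ} (h : box d m ⊆ box d N) (ωb : Finset (Sym2 ↥(box d N))) :
    amb (restrictBox h ωb) = amb ωb ∩ nnEdges (box d m) := by
  ext e
  rw [mem_inter, amb, mem_map]
  constructor
  · rintro ⟨e', he', rfl⟩
    obtain ⟨he'E, he'ω⟩ := mem_filter.1 he'
    induction e' using Sym2.ind with
    | h x y =>
      refine ⟨?_, ?_⟩
      · rw [Function.Embedding.sym2Map_apply, Sym2.map_mk]
        have : s((⟨x.1, h x.2⟩ : ↥(box d N)).1, (⟨y.1, h y.2⟩ : ↥(box d N)).1) ∈ amb ωb := (mk_mem_amb_iff _ _).2 he'ω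
        exact this
      · rw [Function.Embedding.sym2Map_apply, Sym2.map_mk]
        exact mk_mem_nnEdges.2 ⟨(finsetGraph_adj_iff x y).1 ((SimpleGraph.mem_edgeSet _).1 (mem_edgeFinset.1 he'E)), x.2, y.2⟩
  · rintro ⟨he, hem⟩
    induction e using Sym2.ind with
    | h a b =>
      obtain ⟨hab, ha, hb⟩ := mk_mem_nnEdges.1 hem
      refine ⟨s(⟨a, ha⟩, ⟨b, hb⟩), mem_filter.2 ⟨mem_edgeFinset.2 ((SimpleGraph.mem_edgeSet _).2 ((finsetGraph_adj_iff _ _).2 hab)), ?_⟩, rfl⟩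
      rw [edgeLift_mk]
      exact (mk_mem_amb_iff (⟨a, h ha⟩ : ↥(box d N)) ⟨b, h hb⟩).1 he

/-- **The free-box event `{0 ↔ ∂Λ_m in Λ_m}` (pulled back to `Λ_N`) is `Pm m` of the ambient image.**
[cite: Grimmett2006, §4.2 and Prop. (5.11)] -/
theorem mem_preimage_origin_iff {m N : ℕ} (h : box d m ⊆ box d N) {ωb : Finset (Sym2 ↥(box d N))}
    (hωb : ωb ⊆ (finsetGraph (zdGraph d) (box d N)).edgeFinset) :
    finsetRestrict h (↑ωb : Set (Sym2 ↥(box d N))) ∈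
        {ω : Percolation.BondConfig ↥(box d m) | ∃ y : ↥(box d m), y.1 ∈ innerBoundary (zdGraph d) (box d m) ∧
          (Percolation.openGraph ω).Reachable ⟨0, zero_mem_box (d := d) m⟩ y} ↔ Pm m (amb ωb) := by
  rw [finsetRestrict_coe_eq h hωb, Set.mem_setOf_eq, pm_iff_pm_inter (Subset.refl (box d m)), Pm, ← amb_restrictBox h ωb]
  have hsub : restrictBox h ωb ⊆ (finsetGraph (zdGraph d) (box d m)).edgeFinset := filter_subset _ _
  constructor
  · rintro ⟨y, hy, hr⟩; exact ⟨y.1, hy, (reachable_openGraph_iff hsub _ _).1 hr⟩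
  · rintro ⟨y, hy, hr⟩
    exact ⟨⟨y, (mem_filter.1 hy).1⟩, hy, (reachable_openGraph_iff hsub ⟨0, _⟩ ⟨y, _⟩).2 hr⟩

/-! ### In the `dis` ensemble the event forces a big external contour around the origin -/

/-- A site with an open edge is not in the exterior part of a `dis`-volume configuration. [folklore] -/
theorem not_mem_Vext_of_open (hd : 2 ≤ d) {V : Finset (Site d)} {ω : Finset (Sym2 (Site d))} (hω : ω ⊆ freeEdges V)
    {x y : Site d} (hxy : Rcfg ω x y) : x ∉ Vext Phase.dis V hω := fun hx =>
  (good_of_mem_Vext hd hω hx) _ (mk_mem_ballEdges_of_mem_nbrs (mem_nbrs.2 hxy.1)) ((eOpen_dis_iff _ _ _).2 hxy.2)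

/-- **An open chain of a `dis`-volume configuration stays in the hull of one external contour.**
[cite: Grimmett2006, §7.5 (proof of Thm. 7.33, free part)] -/
theorem chain_subset_hull (hd : 2 ≤ d) {V : Finset (Site d)} {ω : Finset (Sym2 (Site d))}
    (hω : ω ⊆ freeEdges V) {γ : (rcSetup d).Γ} (hγ : γ ∈ extContours Phase.dis hω) {U : Finset (Site d)} {x y : Site d}
    (hx : x ∈ (rcSetup d).hull γ) (h : ReflTransGen (relIn (Rcfg ω) U) x y) : y ∈ (rcSetup d).hull γ := by
  induction h with
  | refl => exact hx
  | @tail b c _ hbc ih =>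
    by_contra hc
    have hcO : c ∈ Oblock γ := mem_oblock_of_adj ih hc hbc.1.1
    exact not_mem_Vext_of_open hd hω (rcfg_symm ω _ _ hbc.1) (oblock_subset_Vext hd hω hγ hcO)

/-- **A `★`-connected finite set spans all intermediate values of a coordinate**:
`|a i - b i| + 1 ≤ |S|` for `a, b ∈ S`. [folklore] -/
theorem natAbs_sub_lt_card_of_starConn {S : Finset (Site d)} (hS : StarConn (S : Set (Site d))) {a b : Site d} (ha : a ∈ S) (hb : b ∈ S)
    (i : Fin d) : (a i - b i).natAbs + 1 ≤ #S := by
  classical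
  -- every integer between `a i` and `b i` is attained on `S`
  have key : ∀ c : ℤ, min (a i) (b i) ≤ c → c ≤ max (a i) (b i) → ∃ z ∈ S, z i = c := by
    have hchain := hS a (mem_coe.2 ha) b (mem_coe.2 hb)
    -- generalise over the endpoint
    suffices H : ∀ w, ReflTransGen (starRel (S : Set (Site d))) a w →
        ∀ c : ℤ, min (a i) (w i) ≤ c → c ≤ max (a i) (w i) → ∃ z ∈ S, z i = c from H b hchain
    intro w hw
    induction hw with
    | refl => intro c h1 h2; exact ⟨a, ha, by simp at h1 h2; omega⟩
    | @tail u w _ huw ih =>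
      intro c h1 h2
      have hstep : (u i - w i).natAbs ≤ 1 := (supDist_le_iff.1 (zdStar_adj.1 huw.1).2) i
      by_cases hc : min (a i) (u i) ≤ c ∧ c ≤ max (a i) (u i)
      · exact ih c hc.1 hc.2
      · refine ⟨w, mem_coe.1 huw.2.2, ?_⟩
        rw [not_and_or, not_le, not_le] at hc
        rcases hc with hc | hc
        · simp only [min_le_iff, le_max_iff] at h1 h2 hc ⊢
          rw [lt_min_iff] at hc
          omega
        · simp only [min_le_iff, le_max_iff] at h1 h2
          rw [max_lt_iff] at hc
          omega
  have hsub : (Finset.Icc (min (a i) (b i)) (max (a i) (b i))) ⊆ S.image fun z => z i := fun c hc => by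
    obtain ⟨z, hz, hzc⟩ := key c (Finset.mem_Icc.1 hc).1 (Finset.mem_Icc.1 hc).2
    exact mem_image.2 ⟨z, hz, hzc⟩
  calc (a i - b i).natAbs + 1 = #(Finset.Icc (min (a i) (b i)) (max (a i) (b i))) := by
        rw [Int.card_Icc]; omega
    _ ≤ #(S.image fun z => z i) := card_le_card hsub
    _ ≤ #S := card_image_le

/-- **Last hull point on a coordinate ray**: from a point of the hull, moving in a fixed coordinate
direction one eventually leaves the hull, and the last hull point is a support point.
[cite: FriedliVelenik2017, §7.2.6 (int γ is enclosed by γ̄)] -/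
theorem exists_supp_on_ray (hd : 2 ≤ d) (γ : (rcSetup d).Γ) {x : Site d} (hx : x ∈ (rcSetup d).hull γ) (i : Fin d) (s : ℤ)
    (hs : s = 1 ∨ s = -1) : ∃ k : ℕ, Function.update x i (x i + k * s) ∈ γ.1.supp ∧ Function.update x i (x i + k * s) ∈ (rcSetup d).hull γ := by
  classical
  set H := (rcSetup d).hull γ with hH
  set pt : ℕ → Site d := fun k => Function.update x i (x i + k * s) with hpt
  -- some point of the ray is outside the (bounded) hull
  have hbdd : ∃ K : ℕ, pt K ∉ H := by
    set R := boxRadius H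
    refine ⟨2 * R + 1 + (x i).natAbs, fun hmem => ?_⟩
    have := (mem_box.1 (subset_box_boxRadius H hmem)) i
    simp only [hpt, Function.update_self] at this
    rcases hs with rfl | rfl <;> omega
  -- the least such index is positive; its predecessor is the last hull point
  set K := Nat.find hbdd with hK
  have hK0 : K ≠ 0 := by
    intro h0
    have : pt 0 ∉ H := by rw [← h0]; exact Nat.find_spec hbdd
    apply this
    simp only [hpt, Nat.cast_zero, zero_mul, add_zero, Function.update_eq_self]
    exact hx
  obtain ⟨k, hk⟩ : ∃ k, K = k + 1 := ⟨K - 1, by omega⟩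
  have hkH : pt k ∈ H := by
    by_contra h; exact Nat.find_min hbdd (show k < Nat.find hbdd by omega) h
  have hk1 : pt (k + 1) ∉ H := by rw [← hk, hK]; exact Nat.find_spec hbdd
  have hadj : (zdStar d).Adj (pt k) (pt (k + 1)) := by
    refine zdStar_adj.2 ⟨fun h => ?_, supDist_le_iff.2 fun j => ?_⟩
    · have := congrFun h i; simp only [hpt, Function.update_self] at this; push_cast at this; rcases hs with rfl | rfl <;> omega
    · by_cases hj : j = i
      · subst hj; simp only [hpt, Function.update_self]; push_cast; rcases hs with rfl | rfl <;> omega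
      · simp [hpt, Function.update_of_ne hj]
  exact ⟨k, mem_supp_of_adj_not_mem_hull hd hkH hk1 hadj, hkH⟩

/-- **A hull containing the origin and a point with a coordinate of modulus `m` has support of size
`≥ m + 1`.** [cite: Grimmett2006, §7.5 (large contours around the origin)] -/
theorem card_supp_ge_of_mem_hull (hd : 2 ≤ d) (γ : (rcSetup d).Γ) (h0 : (0 : Site d) ∈ (rcSetup d).hull γ) {y : Site d}
    (hy : y ∈ (rcSetup d).hull γ) {i : Fin d} {m : ℕ} (hyi : (y i).natAbs = m) : m + 1 ≤ #γ.1.supp := by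
  -- push `y` outwards and `0` in the opposite direction
  set s : ℤ := if 0 ≤ y i then 1 else -1 with hs
  have hs' : s = 1 ∨ s = -1 := by rw [hs]; split_ifs <;> simp
  have hs'' : -s = 1 ∨ -s = -1 := by rcases hs' with h | h <;> simp [h]
  obtain ⟨k₁, ha, -⟩ := exists_supp_on_ray hd γ hy i s hs'
  obtain ⟨k₂, hb, -⟩ := exists_supp_on_ray hd γ h0 i (-s) hs''
  have := natAbs_sub_lt_card_of_starConn ((rcSetup d).supp_starConn γ) ha hb i
  simp only [Function.update_self, Pi.zero_apply, zero_add] at this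
  change _ ≤ #γ.1.supp at this
  have hk : m ≤ (y i + ↑k₁ * s - ↑k₂ * -s).natAbs := by
    rw [hs]; split_ifs with h0y <;> omega
  omega

/-- **In the `dis` ensemble of `Λ_{N+3}`, the event `0 ↔ ∂Λ_m in Λ_m` (`1 ≤ m`) forces an external
contour whose hull contains the origin and whose support has size `≥ m + 1`.**
[cite: Grimmett2006, §7.5 (proof of Thm. 7.33, free part)] -/
theorem exists_big_hull_of_pm (hd : 2 ≤ d) {m : ℕ} (hm : 1 ≤ m) {ω : Finset (Sym2 (Site d))} (hω : ω ⊆ freeEdges (box d (N + 3)))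
    (hP : Pm m ω) : ∃ γ ∈ extContours Phase.dis hω, (0 : Site d) ∈ (rcSetup d).hull γ ∧ m + 1 ≤ (rcSetup d).size γ := by
  classical
  obtain ⟨y, hy, hchain⟩ := hP
  obtain ⟨hyb, i, hyi⟩ := mem_innerBoundary_box.1 hy
  have hy0 : y ≠ 0 := fun h => by rw [h] at hyi; simp at hyi; omega
  -- the origin has an open edge: first step of the chain
  obtain ⟨c, h0c⟩ : ∃ c, Rcfg ω 0 c := by
    rcases (reflTransGen_iff_eq_or_transGen.1 hchain) with h | h
    · exact absurd h hy0
    · obtain ⟨c, hc, -⟩ := Relation.TransGen.head'_iff.1 h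
      exact ⟨c, hc.1⟩
  have hV := starConn_compl_box hd (N + 3)
  have h0V : (0 : Site d) ∉ Vext Phase.dis (box d (N + 3)) hω := not_mem_Vext_of_open hd hω h0c
  obtain ⟨γ, hγ, h0⟩ : ∃ γ ∈ extContours Phase.dis hω, (0 : Site d) ∈ (rcSetup d).hull γ := by
    have := eq_Vext_union_biUnion_hull hd hω hV (σ := Phase.dis)
    have h0 : (0 : Site d) ∈ box d (N + 3) := zero_mem_box (d := d) _
    rw [this, mem_union, mem_biUnion] at h0
    exact h0.resolve_left h0V
  refine ⟨γ, hγ, h0, ?_⟩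
  exact card_supp_ge_of_mem_hull hd γ h0 (chain_subset_hull hd hω hγ h0 hchain) hyi

end Free



/-! ## Part 3: the Peierls sums -/

section Sums

variable (hd : 2 ≤ d) {t q : ℝ} (ht : 0 < t) (hq : 0 < q)

/-! ### The union bound from Lemma 7.26 -/

include hd in
/-- External contours of a configuration of `V` are contours in `V`. [folklore] -/
theorem extOf_subset_contoursIn {σ : Phase} {V : Finset (Site d)} {ω : Finset (Sym2 (Site d))} (hω : ω ⊆ freeEdges V) :
    xc σ V ω ⊆ (rcSetup d).contoursIn σ V := fun γ hγ => by
  rw [xc_eq hω] at hγ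
  obtain ⟨h1, -⟩ := mem_compFam.1 (mem_extFam.1 (extContours_mem_extFam hd hω)).1
  exact mem_contoursIn.2 (h1 γ hγ)

include hd in
/-- **The union bound over external contours**: `ensProb(∃ external γ, P γ) ≤ Σ_{γ ∈ contoursIn, P γ} K(γ)`.
[cite: FriedliVelenik2017, §7.3.2, Lemma 7.26; Grimmett2006, §7.5] -/
theorem ensProb_exists_le {σ : Phase} {V : Finset (Site d)} (hV : StarConn (V : Set (Site d))ᶜ) (P : (rcSetup d).Γ → Prop)
    [DecidablePred P] [DecidablePred fun ω : Finset (Sym2 (Site d)) => ∃ γ ∈ xc σ V ω, P γ] :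
    ensProb t q σ V (fun ω => ∃ γ ∈ xc σ V ω, P γ) ≤ ∑ γ ∈ ((rcSetup d).contoursIn σ V).filter P, (rcModel d ht hq).K γ := by
  classical
  have hZ := Zrc_pos ht hq σ V
  rw [ensProb, div_le_iff₀ hZ, sum_mul]
  have hnn : ∀ (ω : Finset (Sym2 (Site d))) (γ : (rcSetup d).Γ), 0 ≤ (if γ ∈ xc σ V ω then wt t q σ V ω else 0) :=
    fun ω γ => by split_ifs <;> [exact (wt_pos ht hq σ V ω).le; exact le_rfl]
  calc ∑ ω ∈ (freeEdges V).powerset with ∃ γ ∈ xc σ V ω, P γ, wt t q σ V ω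
      ≤ ∑ ω ∈ (freeEdges V).powerset, ∑ γ ∈ ((rcSetup d).contoursIn σ V).filter P, (if γ ∈ xc σ V ω then wt t q σ V ω else 0) := by
        rw [sum_filter]
        refine sum_le_sum fun ω hω => ?_
        split_ifs with h
        · obtain ⟨γ, hγ, hP⟩ := h
          calc wt t q σ V ω = (if γ ∈ xc σ V ω then wt t q σ V ω else 0) := (if_pos hγ).symm
            _ ≤ _ := single_le_sum (f := fun γ => if γ ∈ xc σ V ω then wt t q σ V ω else 0) (fun γ _ => hnn ω γ)
                (mem_filter.2 ⟨extOf_subset_contoursIn hd (mem_powerset.1 hω) hγ, hP⟩)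
        · exact sum_nonneg fun γ _ => hnn ω γ
    _ = ∑ γ ∈ ((rcSetup d).contoursIn σ V).filter P, ∑ ω ∈ (freeEdges V).powerset with γ ∈ xc σ V ω, wt t q σ V ω := by
        rw [sum_comm]; exact sum_congr rfl fun γ _ => (sum_filter _ _).symm
    _ ≤ ∑ γ ∈ ((rcSetup d).contoursIn σ V).filter P, (rcModel d ht hq).K γ * Zrc t q σ V :=
        sum_le_sum fun γ hγ => sum_wt_filter_le_K_mul hd ht hq hV (mem_filter.1 hγ).1

/-! ### Counting contours around the origin -/

include hd in
/-- **A contour whose hull contains the origin has a support point `k e₀` with `k < |γ̄|`.**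
[cite: Grimmett2006, §7.5 (counting contours surrounding the origin)] -/
theorem exists_supp_on_axis (γ : (rcSetup d).Γ) (h0 : (0 : Site d) ∈ (rcSetup d).hull γ) :
    ∃ k : ℕ, k + 1 ≤ (rcSetup d).size γ ∧ Function.update (0 : Site d) ⟨0, by omega⟩ (k : ℤ) ∈ γ.1.supp := by
  set i : Fin d := ⟨0, by omega⟩
  obtain ⟨k, ha, -⟩ := exists_supp_on_ray hd γ h0 i 1 (Or.inl rfl)
  obtain ⟨k', hb, -⟩ := exists_supp_on_ray hd γ h0 i (-1) (Or.inr rfl)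
  have := natAbs_sub_lt_card_of_starConn ((rcSetup d).supp_starConn γ) ha hb i
  simp only [Function.update_self, Pi.zero_apply, zero_add, mul_one, mul_neg] at this
  refine ⟨k, ?_, by simpa using ha⟩
  change _ ≤ #γ.1.supp at this
  change k + 1 ≤ #γ.1.supp
  omega

include hd in
/-- **Counting contours of given size around the origin**:
`#{γ ∈ contoursIn σ V : 0 ∈ hull γ, |γ̄| = s} ≤ s · (3^d)^{2(s-1)} · (4^{3^d})^s`.
[cite: Grimmett2006, §7.5; FriedliVelenik2017, Lemma 3.38 (lattice animals)] -/
theorem card_filter_hull_size_le (σ : Phase) (V : Finset (Site d)) (s : ℕ) :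
    #(((rcSetup d).contoursIn σ V).filter fun γ => (0 : Site d) ∈ (rcSetup d).hull γ ∧ (rcSetup d).size γ = s) ≤
      s * ((3 ^ d) ^ (2 * (s - 1)) * (4 ^ 3 ^ d) ^ s) := by
  classical
  set i : Fin d := ⟨0, by omega⟩
  set pt : ℕ → Site d := fun k => Function.update (0 : Site d) i (k : ℤ) with hpt
  set T := ((rcSetup d).contoursIn σ V).filter fun γ => (0 : Site d) ∈ (rcSetup d).hull γ ∧ (rcSetup d).size γ = s
  set Tk : ℕ → Finset (rcSetup d).Γ := fun k => ((rcSetup d).contoursIn σ V).filter fun γ => pt k ∈ γ.1.supp ∧ (rcSetup d).size γ = s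
  -- every counted contour has an axis point in its support
  have hsub : T ⊆ (range s).biUnion Tk := fun γ hγ => by
    obtain ⟨hγc, h0, hsz⟩ := mem_filter.1 hγ
    obtain ⟨k, hk, hks⟩ := exists_supp_on_axis hd γ h0
    exact mem_biUnion.2 ⟨k, mem_range.2 (by rw [hsz] at hk; omega), mem_filter.2 ⟨hγc, hks, hsz⟩⟩
  -- each `Tk k` is counted through the supports
  have hTk : ∀ k, #(Tk k) ≤ (3 ^ d) ^ (2 * (s - 1)) * (4 ^ 3 ^ d) ^ s := by
    intro k
    set 𝒮 := (Tk k).image fun γ => γ.1.supp with h𝒮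
    have h1 : Tk k ⊆ 𝒮.biUnion fun S => (rcSetup d).withSupp S := fun γ hγ =>
      mem_biUnion.2 ⟨γ.1.supp, mem_image_of_mem _ hγ, ((rcSetup d).mem_withSupp _ _).2 rfl⟩
    have h2 : #𝒮 ≤ (3 ^ d) ^ (2 * (s - 1)) := card_filter_starConn_le (pt k) s 𝒮 fun S hS => by
      obtain ⟨γ, hγ, rfl⟩ := mem_image.1 hS
      obtain ⟨-, hpk, hsz⟩ := mem_filter.1 hγ
      exact ⟨hpk, hsz, (rcSetup d).supp_starConn γ⟩
    calc #(Tk k) ≤ #(𝒮.biUnion fun S => (rcSetup d).withSupp S) := card_le_card h1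
      _ ≤ ∑ S ∈ 𝒮, #((rcSetup d).withSupp S) := card_biUnion_le
      _ ≤ ∑ S ∈ 𝒮, (4 ^ 3 ^ d) ^ s := sum_le_sum fun S hS => by
          obtain ⟨γ, hγ, rfl⟩ := mem_image.1 hS
          obtain ⟨-, -, hsz⟩ := mem_filter.1 hγ
          have := card_withSupp_rcSetup_le (d := d) γ.1.supp
          rw [show #γ.1.supp = s from hsz] at this
          exact this
      _ = #𝒮 * (4 ^ 3 ^ d) ^ s := by rw [sum_const, smul_eq_mul]
      _ ≤ (3 ^ d) ^ (2 * (s - 1)) * (4 ^ 3 ^ d) ^ s := Nat.mul_le_mul_right _ h2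
  calc #T ≤ #((range s).biUnion Tk) := card_le_card hsub
    _ ≤ ∑ k ∈ range s, #(Tk k) := card_biUnion_le
    _ ≤ ∑ k ∈ range s, (3 ^ d) ^ (2 * (s - 1)) * (4 ^ 3 ^ d) ^ s := sum_le_sum fun k _ => hTk k
    _ = s * ((3 ^ d) ^ (2 * (s - 1)) * (4 ^ 3 ^ d) ^ s) := by rw [sum_const, card_range, smul_eq_mul]

/-! ### The geometric tail bound -/

/-- A finite tail of a geometric series. [folklore] -/
theorem sum_range_ite_pow_le {y : ℝ} (hy0 : 0 ≤ y) (hy1 : y < 1) (m T : ℕ) :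
    ∑ s ∈ range (T + 1), (if m + 1 ≤ s then y ^ s else 0) ≤ y ^ (m + 1) / (1 - y) := by
  rw [← sum_filter, show (range (T + 1)).filter (fun s => m + 1 ≤ s) = Ico (m + 1) (T + 1) from by
    ext s; rw [mem_filter, mem_range, mem_Ico]; omega]
  exact geom_sum_Ico_le_of_lt_one hy0 hy1

/-- `s ≤ 2^s`. [folklore] -/
theorem cast_le_two_pow (s : ℕ) : (s : ℝ) ≤ 2 ^ s := by exact_mod_cast Nat.lt_two_pow_self.le

/-- The crude count bound in exponential form: `s (3^d)^{2(s-1)} (4^{3^d})^s ≤ (2 · 9^d · 4^{3^d})^s`. [folklore] -/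
theorem count_le_pow (s : ℕ) : (s : ℝ) * ((3 ^ d) ^ (2 * (s - 1)) * (4 ^ 3 ^ d) ^ s) ≤ ((2 : ℝ) * 9 ^ d * 4 ^ 3 ^ d) ^ s := by
  have h1 : ((3 : ℝ) ^ d) ^ (2 * (s - 1)) ≤ (9 ^ d) ^ s := by
    rw [← pow_mul, show (9 : ℝ) = 3 ^ 2 by norm_num, ← pow_mul, ← pow_mul]
    exact pow_le_pow_right₀ (by norm_num) (by nlinarith [Nat.sub_le s 1])
  calc (s : ℝ) * ((3 ^ d) ^ (2 * (s - 1)) * (4 ^ 3 ^ d) ^ s) ≤ 2 ^ s * ((9 ^ d) ^ s * (4 ^ 3 ^ d) ^ s) := by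
        gcongr
        exact cast_le_two_pow s
    _ = (2 * 9 ^ d * 4 ^ 3 ^ d) ^ s := by rw [mul_pow, mul_pow]; ring

include hd in
/-- **The Peierls tail bound**: if every contour of type `σ` satisfies `K(γ) ≤ e^{-τ̂|γ̄|}` and
`B := 2·9^d·4^{3^d}·e^{-τ̂} < 1`, then
`Σ_{γ ∈ contoursIn σ V : 0 ∈ hull γ, |γ̄| ≥ m+1} K(γ) ≤ B^{m+1}/(1-B)`, uniformly in the volume.
[cite: Grimmett2006, §7.5 (proof of Thm. 7.33, eqs. (7.79)–(7.82)); FriedliVelenik2017, §7.4] -/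
theorem sum_K_hull_ge_le {σ : Phase} (V : Finset (Site d)) {τh : ℝ}
    (hK : ∀ γ : (rcSetup d).Γ, (rcSetup d).type γ = σ → (rcModel d ht hq).K γ ≤ Real.exp (-τh * (rcSetup d).size γ))
    (hB : (2 : ℝ) * 9 ^ d * 4 ^ 3 ^ d * Real.exp (-τh) < 1) (m : ℕ) :
    ∑ γ ∈ ((rcSetup d).contoursIn σ V).filter (fun γ => (0 : Site d) ∈ (rcSetup d).hull γ ∧ m + 1 ≤ (rcSetup d).size γ),
        (rcModel d ht hq).K γ ≤
      ((2 : ℝ) * 9 ^ d * 4 ^ 3 ^ d * Real.exp (-τh)) ^ (m + 1) / (1 - 2 * 9 ^ d * 4 ^ 3 ^ d * Real.exp (-τh)) := by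
  classical
  set B : ℝ := 2 * 9 ^ d * 4 ^ 3 ^ d * Real.exp (-τh) with hBdef
  have hB0 : 0 ≤ B := by positivity
  set C := (rcSetup d).contoursIn σ V with hC
  set Smax := C.sup (rcSetup d).size with hSmax
  -- group by size
  have hgroup : ∑ γ ∈ C.filter (fun γ => (0 : Site d) ∈ (rcSetup d).hull γ ∧ m + 1 ≤ (rcSetup d).size γ), (rcModel d ht hq).K γ =
      ∑ s ∈ range (Smax + 1), ∑ γ ∈ (C.filter (fun γ => (0 : Site d) ∈ (rcSetup d).hull γ ∧ m + 1 ≤ (rcSetup d).size γ)).filter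
        (fun γ => (rcSetup d).size γ = s), (rcModel d ht hq).K γ := by
    rw [sum_fiberwise_of_maps_to (g := (rcSetup d).size)]
    intro γ hγ
    exact mem_range.2 (Nat.lt_succ_of_le (le_sup (f := (rcSetup d).size) (mem_filter.1 hγ).1))
  rw [hgroup]
  -- bound each size class
  have hclass : ∀ s, ∑ γ ∈ (C.filter (fun γ => (0 : Site d) ∈ (rcSetup d).hull γ ∧ m + 1 ≤ (rcSetup d).size γ)).filter
      (fun γ => (rcSetup d).size γ = s), (rcModel d ht hq).K γ ≤ if m + 1 ≤ s then B ^ s else 0 := by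
    intro s
    split_ifs with hms
    · calc ∑ γ ∈ (C.filter (fun γ => (0 : Site d) ∈ (rcSetup d).hull γ ∧ m + 1 ≤ (rcSetup d).size γ)).filter
            (fun γ => (rcSetup d).size γ = s), (rcModel d ht hq).K γ
          ≤ ∑ γ ∈ (C.filter (fun γ => (0 : Site d) ∈ (rcSetup d).hull γ ∧ m + 1 ≤ (rcSetup d).size γ)).filter
            (fun γ => (rcSetup d).size γ = s), Real.exp (-τh * s) := sum_le_sum fun γ hγ => by
              obtain ⟨hγ', hsz⟩ := mem_filter.1 hγ
              have := hK γ (mem_contoursIn.1 (mem_filter.1 hγ').1).1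
              rwa [hsz] at this
        _ = #((C.filter (fun γ => (0 : Site d) ∈ (rcSetup d).hull γ ∧ m + 1 ≤ (rcSetup d).size γ)).filter
            (fun γ => (rcSetup d).size γ = s)) * Real.exp (-τh * s) := by rw [sum_const, nsmul_eq_mul]
        _ ≤ (s * ((3 ^ d) ^ (2 * (s - 1)) * (4 ^ 3 ^ d) ^ s) : ℕ) * Real.exp (-τh * s) := by
            gcongr
            refine (card_le_card fun γ hγ => ?_).trans (card_filter_hull_size_le hd σ V s)
            obtain ⟨hγ', hsz⟩ := mem_filter.1 hγ
            obtain ⟨hγC, h0, -⟩ := mem_filter.1 hγ'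
            exact mem_filter.2 ⟨hγC, h0, hsz⟩
        _ ≤ (2 * 9 ^ d * 4 ^ 3 ^ d) ^ s * Real.exp (-τh * s) := by
            gcongr
            push_cast
            exact count_le_pow s
        _ = B ^ s := by
            rw [hBdef, show Real.exp (-τh * (s : ℝ)) = Real.exp (-τh) ^ s from by
              rw [← Real.exp_nat_mul]; ring_nf]
            ring
    · refine (sum_eq_zero fun γ hγ => ?_).le
      obtain ⟨hγ', hsz⟩ := mem_filter.1 hγ
      obtain ⟨-, -, hm⟩ := mem_filter.1 hγ'
      omega
  exact (sum_le_sum fun s _ => hclass s).trans (sum_range_ite_pow_le hB0 hB m Smax)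

include hd in
/-- The total Peierls sum (all sizes). [cite: Grimmett2006, §7.5, eq. (7.79)] -/
theorem sum_K_hull_le {σ : Phase} (V : Finset (Site d)) {τh : ℝ}
    (hK : ∀ γ : (rcSetup d).Γ, (rcSetup d).type γ = σ → (rcModel d ht hq).K γ ≤ Real.exp (-τh * (rcSetup d).size γ))
    (hB : (2 : ℝ) * 9 ^ d * 4 ^ 3 ^ d * Real.exp (-τh) < 1) :
    ∑ γ ∈ ((rcSetup d).contoursIn σ V).filter (fun γ => (0 : Site d) ∈ (rcSetup d).hull γ), (rcModel d ht hq).K γ ≤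
      ((2 : ℝ) * 9 ^ d * 4 ^ 3 ^ d * Real.exp (-τh)) / (1 - 2 * 9 ^ d * 4 ^ 3 ^ d * Real.exp (-τh)) := by
  have h := sum_K_hull_ge_le hd ht hq V hK hB 0
  rw [zero_add, pow_one] at h
  refine le_trans (le_of_eq (sum_congr ?_ fun _ _ => rfl)) h
  refine filter_congr fun γ _ => ⟨fun h0 => ⟨h0, card_pos.2 ((rcSetup d).supp_nonempty γ)⟩, fun h' => h'.1⟩

end Sums

end RCC

end Literature.Probability.LatticeModels

end
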